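import Literature.Analysis.InnerProduct.OddSphereHeatTraceExpansion
import Literature.Analysis.InnerProduct.OddPowerGaussianSumAsymptotics
import HarnessLib

/-!
# The hemispheres `S^{2m+1}_±` of EVERY odd-dimensional round sphere, Dirichlet and Neumann, to all orders:
# `Z_{D/N}(t) = ½Z_{S^{2m+1}}(t) ∓ ½E_m(t)`, `E_m(t) = ∑_K C(K+2m−1, 2m−1)e^{−tK(K+2m)} = e^{m²t}∑_{n≥0} n·B_m(n²)e^{−tn²}` —
# the interior invariants at the HALF-integers (half of `S^{2m+1}`, finitely many, row g39-#2), the boundary invariants at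
# the INTEGERS `t^{−m}, t^{1−m}, …` with Bernoulli-number coefficients (Zagier's `∑ bₙζ(−n)tⁿ`, row g41-#1): McKean–Singer's
# `±¼√(4πt)·area(∂)` and all its successors; Weyl, `ζ_D(0) = −½E_{m,m}`, `ζ_N(0) = ½E_{m,m} − 1`, and the INTEGER pole
# `s = m` (residues `∓1/(4(2m−1)!)`) that the closed `S^{2m+1}` does not have

Layer `Literature/Analysis/InnerProduct`, namespace `Literature.Analysis.InnerProduct`; sequel BY IMPORT of row g39-#2
(`OddSphereHeatTraceExpansion.lean`, the closed spheres `S^{2m+1}`: REUSED `hasSum_oddSphere_multiplicity`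
(`Z = ½e^{m²t}∑_{n∈ℤ}q_m(n²)e^{−tn²}`), `tsum_oddSphere`, `prod_range_two_mul_add_one_eq` (pairing), `tendsto_natCast_mul_add_atTop`,
`isBigO_oddSphere_heatTrace_expansion` (THE expansion of `S^{2m+1}`, index `Fin (m+1) × Fin (N+1)`), `coeff_oddSphere_poly_self`,
`Gamma_add_half_div_factorial_two_mul`, the family lemmas `hasSum_sigma_fin_of_hasSum_natCast_mul`, `tendsto_sigma_fin_cofinite_atTop`,
`ncard_setOf_sigma_fin_eq`) and of row g41-#1 (`OddPowerGaussianSumAsymptotics.lean`: REUSED Zagier's expansion on the integer grid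
`isBigO_tsum_pow_mul_exp_neg_mul_sq_sub` — `∑_{n≥0} n^{2k+1}e^{−tn²} − k!/(2t^{k+1}) − ∑_{i<N} r_{k,i}tⁱ = O(t^N)`,
`r_{k,i} = (−1)^{i+1}B_{2(k+i+1)}/(2(k+i+1)·i!)` — and `summable_pow_mul_exp_neg_mul_sq`). This is the every-`m` version of row
g40-#4 (`ThreeSphereHemisphereHeatTraceExpansion.lean`, `S³₊`), which it recovers for `m = 1` (`oddHemisphere_one_boundaryCoeff`:
`½, 5/12, 19/120`), and the odd-dimensional companion of row g41-#3 (`EvenSphereHemisphereHeatTraceExpansion.lean`, where the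
roles are swapped: boundary terms at the half-integers, given by a theta function). Lane `lit-hodgefound` (Track 2
foundations library), prover seat `lit-hodgefound-p06` (generation 41), self-proposed row g41-#6. THEOREMS ONLY (no definition,
no instance, no notation, no named fact; the polynomials `q_m = (2/(2m)!)X∏_{i=1}^{m−1}(X − i²)` (sphere) and
`B_m = ∏_{i=1}^{m−1}(X − i²)/(2m−1)!` (boundary) and all coefficients are written out).

## Sources, verbatim

P. Freitas, J. Mao, I. Salavessa, *Pólya-type inequalities on spheres and hemispheres*, Ann. Inst. Fourier (2025),
arXiv:2204.07277 (held text `paper:arxiv-2204.07277`). §2.2 (chunk p0006): "The distinct eigenvalues of `S^n_+` are given by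
(cf. [bb], [bsj]) `λ̄_K = K(K+n−1)`, `K = 1, 2, …`, with multiplicity `m(K) = binom(n+K−2, n−1) = binom(n+K−2, K−1) =
K^{\overline{n−1}}/(n−1)!`" (Dirichlet; here `n = 2m+1`: `K(K+2m)` with multiplicity `C(K+2m−1, 2m)`); §2.1 (p0005): "`m(K) =
binom(n+K, n) − binom(n+K−2, n)`" (the closed sphere); §1.3 (p0004): "the spectrum of `Sⁿ` consists of the union of the
Dirichlet and Neumann spectra on `Sⁿ₊`" (so the Neumann multiplicity is `m_{Sⁿ}(K) − C(K+2m−1,2m) = C(K+2m, 2m)`: Pascal, with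
Kirsten's `m_{S^{2m+1}}(K) = C(K+2m,2m) + C(K+2m−1,2m)`).
H. P. McKean, I. M. Singer, *Curvature and the eigenvalues of the Laplacian*, J. Differential Geom. 1 (1967) 43–69, eq. (6)
p. 45 (quoted in rows g40-#3/#4 from the held page): "`(4πt)^{d/2} Z± = the (Riemannian) volume of D ± ¼√(4πt) × the
(Riemannian) surface area of B + (t/3) × the curvatura integra … − (t/6) × the integrated mean curvature … + O(t^{3/2})`"
(`Z⁻` Dirichlet, `Z⁺` Neumann); here `d = 2m+1`, `B = S^{2m}` (totally geodesic), `area B = |S^{2m}| = 2π^{m+½}/Γ(m+½)`: the term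
`±¼√(4πt)·area B/(4πt)^{m+½} = ±[(m−1)!/(4(2m−1)!)]·t^{−m}` (`oddHemisphere_boundaryCoeff_zero_eq_area`).
K. Kirsten, *Spectral Functions in Mathematics and Physics* (2001), §3.2 eqs. (3.2.19)–(3.2.20) (held text p0058, the
degeneracies; `λ_l = l(l+d−1) = (l+(d−1)/2)² − ((d−1)/2)²`) and §4.2 (p0096, "`|S^d| = 2π^{(d+1)/2}/Γ((d+1)/2)`").
D. Zagier, *The Mellin transform and other useful analytic techniques* (appendix to Zeidler, QFT I, 2006), §4 Proposition 3
eq. (42): `∑_{m≥1} f(mt) ∼ I_f/t + ∑ₙ bₙζ(−n)tⁿ` — for `f(x) = x^{2k+1}e^{−x²}` in the variable `t = x²` (row g41-#1).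
P. H. Bérard, *Spectral Geometry* (LNM 1207, 1986), Ch. VII nº1–nº2 (`Z(t) = ∑exp(−λⱼt)`, `a₀ = Vol`), nº10 (ii) (Weyl (11)).
P. B. Gilkey, *Invariance theory …* (2nd ed., 1995), §1.10 Lemma 1.10.1 (poles of `Γ(s)ζ(s,P)`, regular values, zero modes).

## The computation

(1) MULTIPLICITIES. `N(K) = C(K+2m, 2m)`, `D(K) = C(K+2m−1, 2m)`, `N + D = m_{S^{2m+1}}` (row g39-#2's multiplicity, literally) and
`N − D = C(K+2m−1, 2m−1) = (K+1)⋯(K+2m−1)/(2m−1)!`; pairing around the middle factor `K+m =: u`,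
`(K+1)⋯(K+2m−1) = u·∏_{i=1}^{m−1}(u² − i²)`, so `C(K+2m−1, 2m−1) = u·B_m(u²)`, `B_m(X) = ∏_{i=1}^{m−1}(X − i²)/(2m−1)!` — an ODD
polynomial in `u` on the INTEGER grid (for `S^{2m+1}` itself: `q_m(u²) = (2/(2m)!)u²∏(u² − i²)`, even). (2) THE BOUNDARY TRACE.
`K(K+2m) = u² − m²` and `u·B_m(u²) = 0` for `u = 0, 1, …, m−1`, so `E_m(t) := Z_N − Z_D = ∑_K C(K+2m−1,2m−1)e^{−tK(K+2m)} =
e^{m²t}∑_{n≥0}(∑_{k<m} B_{m,k}n^{2k+1})e^{−tn²}`; by row g41-#1 (Zagier ∕ Euler–Maclaurin on the integer grid, every power),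
`t^m·∑_{n≥0}(∑_k B_{m,k}n^{2k+1})e^{−tn²} = ∑_b v_{m,b}t^b + O(t^∞-asymptotic)` with `v_{m,b} = B_{m,m−1−b}(m−1−b)!/2` (`b < m`, the
integrals `I_f = k!/2`) and `v_{m,m+i} = ∑_k B_{m,k}r_{k,i}` (the zeta values), hence, by the Cauchy product with `e^{m²t}`,
`E_m(t) − ∑_{n≤m+N} E_{m,n}t^{n−m} = O(t^{N+1})`, `E_{m,n} = ∑_{a+b=n} (m²)ᵃ/a!·v_{m,b}` — INTEGER POWERS ONLY, infinitely many
nonzero. (3) `Z_D = ½(Z_{S^{2m+1}} − E_m)`, `Z_N = ½(Z_{S^{2m+1}} + E_m)` with row g39-#2 at order `N+m` (`O(t^{N+½})`): on the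
index set `(Fin(m+1) × Fin(N+m+1)) ⊕ Fin(m+N+1)`, `Z_{D/N} − ∑[½·½q_{m,j}Γ(j+½)(m²)^r/r!·t^{r−j−½} | ∓½E_{m,n}t^{n−m}] = O(t^{N+½})`.
(4) CHECKS. `E_{m,0} = v_{m,0} = (m−1)!/(2(2m−1)!)`, `½E_{m,0} = ¼√(4π)(4π)^{−(m+½)}|S^{2m}|` (McKean–Singer); `m = 1`: `E_{1,n} = ½,
5/12, 19/120` (row g40-#4: `Z_{D/N}(S³_±) = √π/(8t^{3/2}) ∓ 1/(4t) + √π/(8√t) ∓ 5/24 + (√π/16)√t ∓ (19/240)t + ⋯`).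
(5) THE MACHINERY: `t^{m+½}Z_{D/N} → ½Γ(m+½)/(2m)!`; Weyl `#{λ ≤ Λ}/Λ^{m+½} → 1/(2m+1)!` (half of `S^{2m+1}`); at `s = 0` only
the integer exponent `0`, i.e. `n = m`, counts: `ζ_D(0) = −½E_{m,m}` (no zero mode), `ζ_N(0) = ½E_{m,m} − 1`; at `s = m` only
`n = 0`: `Res = Γ(m)^{−1}(∓½E_{m,0}) = ∓1/(4(2m−1)!)` (`m = 1`: `∓¼`, row g40-#4).

## What is proved

* §1 `oddHemisphere_multiplicity_neumann_eq_add` (Pascal), **`oddHemisphere_boundary_multiplicity_eq`** (`C(K+2m−1,2m−1) =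
  u·B_m(u²)`), `eval_oddHemisphere_poly_natCast_sq_eq_zero`, `natDegree_oddHemisphere_poly`, `coeff_oddHemisphere_poly_top`,
  `mul_eval_oddHemisphere_poly_eq_sum`.
* §2 **`hasSum_oddHemisphere_boundary_multiplicity`** (`E_m = e^{m²t}∑(∑_k B_{m,k}n^{2k+1})e^{−tn²}`),
  `summable_oddHemisphere_boundary_multiplicity`, **`hasSum_dirichletOddHemisphere_multiplicity`** (`Z_D = ½(Z_S − E_m)`),
  **`hasSum_neumannOddHemisphere_multiplicity`**; the families on `Σ K, Fin D(K)` and `Σ K, Fin N(K)`: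
  `hasSum_/summable_dirichletOddHemisphere`, `hasSum_/summable_neumannOddHemisphere`,
  `tsum_dirichletOddHemisphere_add_tsum_neumannOddHemisphere` (`= Z_{S^{2m+1}}`),
  `tsum_neumannOddHemisphere_sub_tsum_dirichletOddHemisphere` (`= E_m`), `tendsto_dirichlet/neumannOddHemisphere_cofinite_atTop`,
  `ncard_setOf_dirichletOddHemisphere_eq_zero` (`0`), `ncard_setOf_neumannOddHemisphere_eq_zero` (`1`); private
  `natCast_mul_add_eq_zero_iff`.
* §3 **`isBigO_tsum_oddPoly_mul_exp_neg_mul_sq_sub`** (odd polynomial weights on the integer grid, from row g41-#1),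
  **`isBigO_pow_mul_oddHemisphereTheta_sub`** (`t^m·W` collected), **`isBigO_oddHemisphere_boundary_expansion`** (`E_m` to all
  orders, integer powers), **`isBigO_dirichletOddHemisphere_heatTrace_expansion`**, **`isBigO_neumannOddHemisphere_heatTrace_expansion`**
  (THE EXPANSIONS, machinery format `κ = (Fin(m+1) × Fin(N+m+1)) ⊕ Fin(m+N+1)`, `β = N+½`); private `isBigO_eval_sub_sum_coeff`,
  `isBigO_exp_const_mul_sub_sum`, `isBigO_exp_mul_sub_sum_antidiagonal` (copies of row g41-#2's private helpers),
  `isBigO_half_oddSphere_add_mul_boundary_sub`.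
* §4 **`oddHemisphere_boundaryCoeff_zero`** (`E_{m,0} = (m−1)!/(2(2m−1)!)`), **`oddHemisphere_boundaryCoeff_zero_eq_area`**
  (McKEAN–SINGER's `¼√(4π)(4π)^{−(m+½)}|S^{2m}|`), `oddHemisphere_one_boundaryCoeff` (`m = 1`: `½, 5/12, 19/120`, row g40-#4);
  private `bernoulli_two`, `bernoulli_four`.
* §5 **`tendsto_rpow_mul_dirichlet/neumannOddHemisphere_heatTrace`** (`t^{m+½}Z → ½Γ(m+½)/(2m)!`),
  **`tendsto_ncard_dirichlet/neumannOddHemisphere_le_div_rpow`** (WEYL `→ 1/(2m+1)!`),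
  **`tendsto_dirichletOddHemisphereZeta_continuation_nhdsNE_zero`** (`ζ_D(0) = −½E_{m,m}`),
  **`tendsto_neumannOddHemisphereZeta_continuation_nhdsNE_zero`** (`ζ_N(0) = ½E_{m,m} − 1`),
  **`tendsto_sub_mul_dirichlet/neumannOddHemisphereZeta_continuation_top`** (the integer pole `s = m`, residues `∓1/(4(2m−1)!)`);
  private exponent bookkeeping lemmas.

## References

* [FreitasMaoSalavessa2025] P. Freitas, J. Mao, I. Salavessa, *Pólya-type inequalities on spheres and hemispheres*, Ann. Inst.
  Fourier (2025), arXiv:2204.07277, §1.3, §2.1, §2.2.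
* [McKeanSinger1967] H. P. McKean, I. M. Singer, *Curvature and the eigenvalues of the Laplacian*, J. Differential Geom. 1
  (1967) 43–69, eq. (6) p. 45.
* [Kirsten2001] K. Kirsten, *Spectral Functions in Mathematics and Physics*, Chapman & Hall/CRC (2001), §3.2 eqs.
  (3.2.19)–(3.2.20), §4.2.
* [Zagier2006Mellin] D. Zagier, *The Mellin transform and other useful analytic techniques*, appendix to E. Zeidler, *Quantum
  Field Theory I*, Springer (2006) 305–323, §4 Proposition 3 eq. (42).
* [Berard1986] P. H. Bérard, *Spectral Geometry: Direct and Inverse Problems*, LNM 1207, Springer (1986), Ch. VII nº1, nº2,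
  nº10 (ii).
* [Gilkey1995] P. B. Gilkey, *Invariance theory, the heat equation, and the Atiyah–Singer index theorem*, 2nd ed., CRC Press
  (1995), §1.10 Lemma 1.10.1.
-/

noncomputable section

open Real Filter Topology Set Asymptotics Polynomial

namespace Literature.Analysis.InnerProduct

/-! ### §1 The multiplicities: `N(K) = D(K) + C(K+2m−1, 2m−1)`, `C(K+2m−1, 2m−1) = u·B_m(u²)`, `u = K+m` -/

/-- **Pascal on the hemisphere multiplicities**: `C(K+2m, 2m) = C(K+2m−1, 2m) + C(K+2m−1, 2m−1)` — Neumann = Dirichlet +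
the dimension of the degree-`K` polynomials on the equator `ℝ^{2m}`; with row g39-#2's `m_{S^{2m+1}}(K) = C(K+2m,2m) +
C(K+2m−1,2m)` this is "the spectrum of `Sⁿ` consists of the union of the Dirichlet and Neumann spectra on `Sⁿ₊`", `n = 2m+1`.
[cite: FreitasMaoSalavessa2025, §1.3 and §2.2 (`m(K) = binom(n+K−2, n−1)`)] -/
theorem oddHemisphere_multiplicity_neumann_eq_add (m : ℕ) (hm : 1 ≤ m) (l : ℕ) :
    (l + 2 * m).choose (2 * m) = (l + 2 * m - 1).choose (2 * m) + (l + 2 * m - 1).choose (2 * m - 1) := by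
  obtain ⟨M, rfl⟩ : ∃ M, m = M + 1 := ⟨m - 1, by omega⟩
  rw [show l + 2 * (M + 1) = (l + 2 * M + 1) + 1 by ring, show 2 * (M + 1) = (2 * M + 1) + 1 by ring,
    show l + 2 * M + 1 + 1 - 1 = l + 2 * M + 1 by omega, show 2 * M + 1 + 1 - 1 = 2 * M + 1 by omega,
    Nat.choose_succ_succ']
  ring

/-- **THE BOUNDARY WEIGHT IS AN ODD POLYNOMIAL IN `u = K+m`: `C(K+2m−1, 2m−1) = u·B_m(u²)`**, `B_m(X) = ∏_{i=1}^{m−1}(X − i²)/(2m−1)!`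
(`(2m−1)!·C(K+2m−1,2m−1) = (K+1)⋯(K+2m−1) = u·∏_{i=1}^{m−1}(u² − i²)`, pairing `(K+j)(K+2m−j) = u² − (m−j)²`). [cite:
FreitasMaoSalavessa2025, §2.2 (`m(K) = K^{\overline{n−1}}/(n−1)!`); Kirsten2001, §3.2 eq. (3.2.19) (the substitution `ν = l + (d−1)/2`)] -/
theorem oddHemisphere_boundary_multiplicity_eq (m : ℕ) (hm : 1 ≤ m) (l : ℕ) :
    (((l + 2 * m - 1).choose (2 * m - 1) : ℕ) : ℝ) = ((l : ℝ) + m) * (C (1 / ((2 * m - 1).factorial : ℝ)) * ∏ i ∈ Finset.range (m - 1), (X - C (((i : ℝ) + 1) ^ 2))).eval (((l : ℝ) + m) ^ 2) := by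
  obtain ⟨M, rfl⟩ : ∃ M, m = M + 1 := ⟨m - 1, by omega⟩
  have h1 : (((2 * M + 1).factorial : ℕ) : ℝ) * (((l + (2 * M + 1)).choose (2 * M + 1) : ℕ) : ℝ) =
      ∏ j ∈ Finset.range (2 * M + 1), ((l : ℝ) + 1 + j) := by
    rw [← Nat.cast_mul, ← Nat.ascFactorial_eq_factorial_mul_choose, Nat.ascFactorial_eq_prod_range]
    push_cast
    exact Finset.prod_congr rfl fun j _ ↦ by ring
  rw [prod_range_two_mul_add_one_eq M l] at h1
  rw [show l + 2 * (M + 1) - 1 = l + (2 * M + 1) by omega, show 2 * (M + 1) - 1 = 2 * M + 1 by omega,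
    show M + 1 - 1 = M by omega]
  simp only [eval_mul, eval_C, eval_prod, eval_sub, eval_X]
  have hF : (((2 * M + 1).factorial : ℕ) : ℝ) ≠ 0 := by positivity
  push_cast at h1 ⊢
  have e : ∏ i ∈ Finset.range M, (((l : ℝ) + ((M : ℝ) + 1)) ^ 2 - ((i : ℝ) + 1) ^ 2) =
      ∏ i ∈ Finset.range M, (((l : ℝ) + M + 1) ^ 2 - ((i : ℝ) + 1) ^ 2) :=
    Finset.prod_congr rfl fun i _ ↦ by ring
  rw [e]
  field_simp
  linear_combination h1

/-- `B_m(n²) = 0` for the integers `1 ≤ n ≤ m−1` (the factor `X − n²`). [cite: Kirsten2001, §3.2 eq. (3.2.19)] -/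
theorem eval_oddHemisphere_poly_natCast_sq_eq_zero (m : ℕ) {n : ℕ} (hn : 1 ≤ n) (hnm : n < m) :
    (C (1 / ((2 * m - 1).factorial : ℝ)) * ∏ i ∈ Finset.range (m - 1), (X - C (((i : ℝ) + 1) ^ 2))).eval (((n : ℝ)) ^ 2) = 0 := by
  simp only [eval_mul, eval_C, eval_X, eval_prod, eval_sub]
  have hmem : n - 1 ∈ Finset.range (m - 1) := Finset.mem_range.mpr (by omega)
  rw [Finset.prod_eq_zero hmem, mul_zero]
  have : (((n - 1 : ℕ) : ℝ) + 1) = (n : ℝ) := by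
    rw [Nat.cast_sub hn]; push_cast; ring
  rw [this, sub_self]

/-- `B_m` has degree `m − 1`. [cite: Kirsten2001, §3.2 eq. (3.2.19)] -/
theorem natDegree_oddHemisphere_poly (m : ℕ) :
    (C (1 / ((2 * m - 1).factorial : ℝ)) * ∏ i ∈ Finset.range (m - 1), (X - C (((i : ℝ) + 1) ^ 2))).natDegree = m - 1 := by
  have hdeg : (∏ i ∈ Finset.range (m - 1), (X - C (((i : ℝ) + 1) ^ 2)) : ℝ[X]).natDegree = m - 1 := by
    rw [natDegree_prod_of_monic _ _ (fun i _ ↦ monic_X_sub_C _)]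
    simp only [natDegree_X_sub_C, Finset.sum_const, Finset.card_range, smul_eq_mul, mul_one]
  have hc : (1 / ((2 * m - 1).factorial : ℝ)) ≠ 0 := by positivity
  rw [natDegree_C_mul hc, hdeg]

/-- The top coefficient of `B_m` is `1/(2m−1)!`. [cite: Kirsten2001, §3.2 eq. (3.2.19)] -/
theorem coeff_oddHemisphere_poly_top (m : ℕ) :
    (C (1 / ((2 * m - 1).factorial : ℝ)) * ∏ i ∈ Finset.range (m - 1), (X - C (((i : ℝ) + 1) ^ 2))).coeff (m - 1) = 1 / ((2 * m - 1).factorial : ℝ) := by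
  have hmon : (∏ i ∈ Finset.range (m - 1), (X - C (((i : ℝ) + 1) ^ 2)) : ℝ[X]).Monic :=
    monic_prod_of_monic _ _ fun i _ ↦ monic_X_sub_C _
  have hdeg : (∏ i ∈ Finset.range (m - 1), (X - C (((i : ℝ) + 1) ^ 2)) : ℝ[X]).natDegree = m - 1 := by
    rw [natDegree_prod_of_monic _ _ (fun i _ ↦ monic_X_sub_C _)]
    simp only [natDegree_X_sub_C, Finset.sum_const, Finset.card_range, smul_eq_mul, mul_one]
  have h1 := hmon.coeff_natDegree
  rw [hdeg] at h1
  rw [coeff_C_mul, h1, mul_one]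

/-- `u·B_m(u²)` written out in the odd powers of `u`: `u·B_m(u²) = ∑_{k<m} B_{m,k}u^{2k+1}`. [cite: Kirsten2001, §3.2 eq. (3.2.19)] -/
theorem mul_eval_oddHemisphere_poly_eq_sum (m : ℕ) (hm : 1 ≤ m) (x : ℝ) :
    x * (C (1 / ((2 * m - 1).factorial : ℝ)) * ∏ i ∈ Finset.range (m - 1), (X - C (((i : ℝ) + 1) ^ 2))).eval (x ^ 2) = ∑ k ∈ Finset.range m, (C (1 / ((2 * m - 1).factorial : ℝ)) * ∏ i ∈ Finset.range (m - 1), (X - C (((i : ℝ) + 1) ^ 2))).coeff k * x ^ (2 * k + 1) := by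
  rw [eval_eq_sum_range' (lt_of_eq_of_lt (natDegree_oddHemisphere_poly m) (show m - 1 < m by omega)), Finset.mul_sum]
  exact Finset.sum_congr rfl fun k _ ↦ by ring

/-! ### §2 The heat traces: `E_m = Z_N − Z_D = e^{m²t}∑_{n≥0}(∑_k B_{m,k}n^{2k+1})e^{−tn²}`, `Z_D = ½(Z_{S^{2m+1}} − E_m)`,
`Z_N = ½(Z_{S^{2m+1}} + E_m)` -/

/-- **THE BOUNDARY TRACE `E_m(t) = ∑_{K≥0} C(K+2m−1, 2m−1)e^{−tK(K+2m)} = e^{m²t}∑_{n≥0}(∑_{k<m} B_{m,k}n^{2k+1})e^{−tn²}`**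
(`K(K+2m) = n² − m²`, `n = K+m`; the terms `n < m` vanish). [cite: FreitasMaoSalavessa2025, §1.3 and §2.2; Kirsten2001, §3.2
eqs. (3.2.19)–(3.2.20)] -/
theorem hasSum_oddHemisphere_boundary_multiplicity (m : ℕ) (hm : 1 ≤ m) {t : ℝ} (ht : 0 < t) :
    HasSum (fun l : ℕ ↦ (((l + 2 * m - 1).choose (2 * m - 1) : ℕ) : ℝ) * rexp (-(t * ((l : ℝ) * (l + 2 * m)))))
      (rexp ((m : ℝ) ^ 2 * t) * ∑' n : ℕ, (∑ k ∈ Finset.range m, (C (1 / ((2 * m - 1).factorial : ℝ)) * ∏ i ∈ Finset.range (m - 1), (X - C (((i : ℝ) + 1) ^ 2))).coeff k * (n : ℝ) ^ (2 * k + 1)) *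
        rexp (-(t * ((n : ℝ)) ^ 2))) := by
  set p : ℝ[X] := (C (1 / ((2 * m - 1).factorial : ℝ)) * ∏ i ∈ Finset.range (m - 1), (X - C (((i : ℝ) + 1) ^ 2))) with hp
  set g : ℕ → ℝ := fun n ↦ (∑ k ∈ Finset.range m, p.coeff k * (n : ℝ) ^ (2 * k + 1)) * rexp (-(t * ((n : ℝ)) ^ 2))
    with hg
  have hgs : Summable g := by
    refine (summable_sum (s := Finset.range m) fun k _ ↦
      (summable_pow_mul_exp_neg_mul_sq (2 * k + 1) ht).mul_left (p.coeff k)).congr fun n ↦ ?_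
    simp only [hg, Finset.sum_mul]
    exact Finset.sum_congr rfl fun k _ ↦ by ring
  have h0 : HasSum g (∑' n : ℕ, g n) := hgs.hasSum
  have h1 := (hasSum_nat_add_iff' m).mpr h0
  have hz : ∑ n ∈ Finset.range m, g n = 0 := Finset.sum_eq_zero fun n hn ↦ by
    simp only [hg]
    rw [← mul_eval_oddHemisphere_poly_eq_sum m hm]
    rcases Nat.eq_zero_or_pos n with h0n | h0n
    · subst h0n; simp
    · rw [eval_oddHemisphere_poly_natCast_sq_eq_zero m h0n (Finset.mem_range.mp hn)]
      ring
  rw [hz, sub_zero] at h1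
  have h2 := h1.mul_left (rexp ((m : ℝ) ^ 2 * t))
  refine h2.congr_fun fun l ↦ ?_
  rw [oddHemisphere_boundary_multiplicity_eq m hm l, ← hp]
  simp only [hg]
  rw [← mul_eval_oddHemisphere_poly_eq_sum m hm]
  push_cast
  have e : rexp (-(t * ((l : ℝ) * ((l : ℝ) + 2 * (m : ℝ))))) =
      rexp ((m : ℝ) ^ 2 * t) * rexp (-(t * ((l : ℝ) + m) ^ 2)) := by
    rw [← Real.exp_add]
    congr 1
    ring
  rw [e]
  ring

/-- The boundary trace converges. [cite: FreitasMaoSalavessa2025, §2.2] -/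
theorem summable_oddHemisphere_boundary_multiplicity (m : ℕ) (hm : 1 ≤ m) {t : ℝ} (ht : 0 < t) :
    Summable fun l : ℕ ↦ (((l + 2 * m - 1).choose (2 * m - 1) : ℕ) : ℝ) * rexp (-(t * ((l : ℝ) * (l + 2 * m)))) :=
  (hasSum_oddHemisphere_boundary_multiplicity m hm ht).summable

/-- **THE DIRICHLET HEMISPHERE `S^{2m+1}_+`, SUMMED WITH MULTIPLICITIES: `Z_D(t) = ∑_K C(K+2m−1, 2m)e^{−tK(K+2m)} =
½(Z_{S^{2m+1}}(t) − E_m(t))`** ("`λ̄_K = K(K+n−1)`, `K = 1, 2, …`, with multiplicity `m(K) = binom(n+K−2, n−1)`", `n = 2m+1`; the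
term `K = 0` is `C(2m−1, 2m) = 0`). [cite: FreitasMaoSalavessa2025, §2.2] -/
theorem hasSum_dirichletOddHemisphere_multiplicity (m : ℕ) (hm : 1 ≤ m) {t : ℝ} (ht : 0 < t) :
    HasSum (fun l : ℕ ↦ (((l + 2 * m - 1).choose (2 * m) : ℕ) : ℝ) * rexp (-(t * ((l : ℝ) * (l + 2 * m)))))
      (1 / 2 * ((rexp ((m : ℝ) ^ 2 * t) / 2 * ∑' n : ℤ,
        (C (2 / (Nat.factorial (2 * m) : ℝ)) * X * ∏ i ∈ Finset.range (m - 1), (X - C (((i : ℝ) + 1) ^ 2))).eval (((n : ℝ)) ^ 2) * rexp (-(t * ((n : ℝ)) ^ 2))) - (rexp ((m : ℝ) ^ 2 * t) * ∑' n : ℕ, (∑ k ∈ Finset.range m, (C (1 / ((2 * m - 1).factorial : ℝ)) * ∏ i ∈ Finset.range (m - 1), (X - C (((i : ℝ) + 1) ^ 2))).coeff k * (n : ℝ) ^ (2 * k + 1)) *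
        rexp (-(t * ((n : ℝ)) ^ 2))))) := by
  have h := ((hasSum_oddSphere_multiplicity m hm ht).sub (hasSum_oddHemisphere_boundary_multiplicity m hm ht)).mul_left
    (1 / 2 : ℝ)
  refine h.congr_fun fun l ↦ ?_
  rw [oddHemisphere_multiplicity_neumann_eq_add m hm l]
  push_cast
  ring

/-- **THE NEUMANN HEMISPHERE: `Z_N(t) = ∑_K C(K+2m, 2m)e^{−tK(K+2m)} = ½(Z_{S^{2m+1}}(t) + E_m(t))`** (multiplicity
`m_{S^{2m+1}}(K) − binom(2m+K−1, 2m)`). [cite: FreitasMaoSalavessa2025, §1.3 and §2.1–§2.2] -/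
theorem hasSum_neumannOddHemisphere_multiplicity (m : ℕ) (hm : 1 ≤ m) {t : ℝ} (ht : 0 < t) :
    HasSum (fun l : ℕ ↦ (((l + 2 * m).choose (2 * m) : ℕ) : ℝ) * rexp (-(t * ((l : ℝ) * (l + 2 * m)))))
      (1 / 2 * ((rexp ((m : ℝ) ^ 2 * t) / 2 * ∑' n : ℤ,
        (C (2 / (Nat.factorial (2 * m) : ℝ)) * X * ∏ i ∈ Finset.range (m - 1), (X - C (((i : ℝ) + 1) ^ 2))).eval (((n : ℝ)) ^ 2) * rexp (-(t * ((n : ℝ)) ^ 2))) + (rexp ((m : ℝ) ^ 2 * t) * ∑' n : ℕ, (∑ k ∈ Finset.range m, (C (1 / ((2 * m - 1).factorial : ℝ)) * ∏ i ∈ Finset.range (m - 1), (X - C (((i : ℝ) + 1) ^ 2))).coeff k * (n : ℝ) ^ (2 * k + 1)) *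
        rexp (-(t * ((n : ℝ)) ^ 2))))) := by
  have h := ((hasSum_oddSphere_multiplicity m hm ht).add (hasSum_oddHemisphere_boundary_multiplicity m hm ht)).mul_left
    (1 / 2 : ℝ)
  refine h.congr_fun fun l ↦ ?_
  rw [oddHemisphere_multiplicity_neumann_eq_add m hm l]
  push_cast
  ring

/-- **The Dirichlet hemisphere as a family** on `Σ K, Fin C(K+2m−1, 2m)`: `∑ e^{−tK(K+2m)} = ½(Z_{S^{2m+1}} − E_m)`. [cite:
FreitasMaoSalavessa2025, §2.2; Berard1986, Ch. VII nº1 (ii)] -/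
theorem hasSum_dirichletOddHemisphere (m : ℕ) (hm : 1 ≤ m) {t : ℝ} (ht : 0 < t) :
    HasSum (fun i : (Σ l : ℕ, Fin ((l + 2 * m - 1).choose (2 * m))) ↦ rexp (-(t * ((i.1 : ℝ) * (i.1 + 2 * m))))) (1 / 2 * ((rexp ((m : ℝ) ^ 2 * t) / 2 * ∑' n : ℤ,
        (C (2 / (Nat.factorial (2 * m) : ℝ)) * X * ∏ i ∈ Finset.range (m - 1), (X - C (((i : ℝ) + 1) ^ 2))).eval (((n : ℝ)) ^ 2) * rexp (-(t * ((n : ℝ)) ^ 2))) - (rexp ((m : ℝ) ^ 2 * t) * ∑' n : ℕ, (∑ k ∈ Finset.range m, (C (1 / ((2 * m - 1).factorial : ℝ)) * ∏ i ∈ Finset.range (m - 1), (X - C (((i : ℝ) + 1) ^ 2))).coeff k * (n : ℝ) ^ (2 * k + 1)) *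
        rexp (-(t * ((n : ℝ)) ^ 2))))) :=
  hasSum_sigma_fin_of_hasSum_natCast_mul (d := fun l ↦ (l + 2 * m - 1).choose (2 * m))
    (fun _ ↦ (Real.exp_pos _).le) (hasSum_dirichletOddHemisphere_multiplicity m hm ht)

/-- The Dirichlet heat trace of `S^{2m+1}_+` converges. [cite: FreitasMaoSalavessa2025, §2.2] -/
theorem summable_dirichletOddHemisphere (m : ℕ) (hm : 1 ≤ m) {t : ℝ} (ht : 0 < t) :
    Summable fun i : (Σ l : ℕ, Fin ((l + 2 * m - 1).choose (2 * m))) ↦ rexp (-(t * ((i.1 : ℝ) * (i.1 + 2 * m)))) :=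
  (hasSum_dirichletOddHemisphere m hm ht).summable

/-- **The Neumann hemisphere as a family** on `Σ K, Fin C(K+2m, 2m)`: `∑ e^{−tK(K+2m)} = ½(Z_{S^{2m+1}} + E_m)`. [cite:
FreitasMaoSalavessa2025, §1.3; Berard1986, Ch. VII nº1 (ii)] -/
theorem hasSum_neumannOddHemisphere (m : ℕ) (hm : 1 ≤ m) {t : ℝ} (ht : 0 < t) :
    HasSum (fun i : (Σ l : ℕ, Fin ((l + 2 * m).choose (2 * m))) ↦ rexp (-(t * ((i.1 : ℝ) * (i.1 + 2 * m))))) (1 / 2 * ((rexp ((m : ℝ) ^ 2 * t) / 2 * ∑' n : ℤ,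
        (C (2 / (Nat.factorial (2 * m) : ℝ)) * X * ∏ i ∈ Finset.range (m - 1), (X - C (((i : ℝ) + 1) ^ 2))).eval (((n : ℝ)) ^ 2) * rexp (-(t * ((n : ℝ)) ^ 2))) + (rexp ((m : ℝ) ^ 2 * t) * ∑' n : ℕ, (∑ k ∈ Finset.range m, (C (1 / ((2 * m - 1).factorial : ℝ)) * ∏ i ∈ Finset.range (m - 1), (X - C (((i : ℝ) + 1) ^ 2))).coeff k * (n : ℝ) ^ (2 * k + 1)) *
        rexp (-(t * ((n : ℝ)) ^ 2))))) :=
  hasSum_sigma_fin_of_hasSum_natCast_mul (d := fun l ↦ (l + 2 * m).choose (2 * m))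
    (fun _ ↦ (Real.exp_pos _).le) (hasSum_neumannOddHemisphere_multiplicity m hm ht)

/-- The Neumann heat trace of `S^{2m+1}_+` converges. [cite: FreitasMaoSalavessa2025, §1.3] -/
theorem summable_neumannOddHemisphere (m : ℕ) (hm : 1 ≤ m) {t : ℝ} (ht : 0 < t) :
    Summable fun i : (Σ l : ℕ, Fin ((l + 2 * m).choose (2 * m))) ↦ rexp (-(t * ((i.1 : ℝ) * (i.1 + 2 * m)))) :=
  (hasSum_neumannOddHemisphere m hm ht).summable

/-- **`Z_D(t) + Z_N(t) = Z_{S^{2m+1}}(t)`**. [cite: FreitasMaoSalavessa2025, §1.3] -/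
theorem tsum_dirichletOddHemisphere_add_tsum_neumannOddHemisphere (m : ℕ) (hm : 1 ≤ m) {t : ℝ} (ht : 0 < t) :
    ∑' i : (Σ l : ℕ, Fin ((l + 2 * m - 1).choose (2 * m))), rexp (-(t * ((i.1 : ℝ) * (i.1 + 2 * m)))) + ∑' i : (Σ l : ℕ, Fin ((l + 2 * m).choose (2 * m))), rexp (-(t * ((i.1 : ℝ) * (i.1 + 2 * m)))) = ∑' i : (Σ l : ℕ, Fin ((l + 2 * m).choose (2 * m) + (l + 2 * m - 1).choose (2 * m))), rexp (-(t * ((i.1 : ℝ) * (i.1 + 2 * m)))) := by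
  rw [(hasSum_dirichletOddHemisphere m hm ht).tsum_eq, (hasSum_neumannOddHemisphere m hm ht).tsum_eq, tsum_oddSphere m hm ht]
  ring

/-- **`Z_N(t) − Z_D(t) = E_m(t) = ∑_K C(K+2m−1, 2m−1)e^{−tK(K+2m)}`**. [cite: FreitasMaoSalavessa2025, §1.3 and §2.2] -/
theorem tsum_neumannOddHemisphere_sub_tsum_dirichletOddHemisphere (m : ℕ) (hm : 1 ≤ m) {t : ℝ} (ht : 0 < t) :
    ∑' i : (Σ l : ℕ, Fin ((l + 2 * m).choose (2 * m))), rexp (-(t * ((i.1 : ℝ) * (i.1 + 2 * m)))) - ∑' i : (Σ l : ℕ, Fin ((l + 2 * m - 1).choose (2 * m))), rexp (-(t * ((i.1 : ℝ) * (i.1 + 2 * m)))) =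
      ∑' l : ℕ, (((l + 2 * m - 1).choose (2 * m - 1) : ℕ) : ℝ) * rexp (-(t * ((l : ℝ) * (l + 2 * m)))) := by
  rw [(hasSum_dirichletOddHemisphere m hm ht).tsum_eq, (hasSum_neumannOddHemisphere m hm ht).tsum_eq,
    (hasSum_oddHemisphere_boundary_multiplicity m hm ht).tsum_eq]
  ring

/-- The Dirichlet eigenvalues with multiplicity tend to `∞`. [cite: Berard1986, Ch. VII nº1 (i); FreitasMaoSalavessa2025, §2.2] -/
theorem tendsto_dirichletOddHemisphere_cofinite_atTop (m : ℕ) :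
    Tendsto (fun i : (Σ l : ℕ, Fin ((l + 2 * m - 1).choose (2 * m))) ↦ ((i.1 : ℝ) * (i.1 + 2 * m))) cofinite atTop :=
  tendsto_sigma_fin_cofinite_atTop (tendsto_natCast_mul_add_atTop m)

/-- The Neumann eigenvalues with multiplicity tend to `∞`. [cite: Berard1986, Ch. VII nº1 (i); FreitasMaoSalavessa2025, §1.3] -/
theorem tendsto_neumannOddHemisphere_cofinite_atTop (m : ℕ) :
    Tendsto (fun i : (Σ l : ℕ, Fin ((l + 2 * m).choose (2 * m))) ↦ ((i.1 : ℝ) * (i.1 + 2 * m))) cofinite atTop :=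
  tendsto_sigma_fin_cofinite_atTop (tendsto_natCast_mul_add_atTop m)

/-- `K(K+2m) = 0 ↔ K = 0` (`m ≥ 1`). [folklore] -/
private theorem natCast_mul_add_eq_zero_iff (m : ℕ) (hm : 1 ≤ m) (l : ℕ) : (l : ℝ) * (l + 2 * m) = 0 ↔ l = 0 := by
  have hm1 : (1 : ℝ) ≤ m := by exact_mod_cast hm
  constructor
  · intro h
    rcases mul_eq_zero.mp h with h | h
    · exact_mod_cast h
    · have : (0 : ℝ) < (l : ℝ) + 2 * m := by linarith [(l.cast_nonneg : (0 : ℝ) ≤ l)]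
      linarith
  · rintro rfl; simp

/-- **The Dirichlet hemisphere has NO zero mode** (`D(0) = C(2m−1, 2m) = 0`). [cite: FreitasMaoSalavessa2025, §2.2] -/
theorem ncard_setOf_dirichletOddHemisphere_eq_zero (m : ℕ) (hm : 1 ≤ m) :
    {i : (Σ l : ℕ, Fin ((l + 2 * m - 1).choose (2 * m))) | ((i.1 : ℝ) * (i.1 + 2 * m)) = 0}.ncard = 0 := by
  rw [ncard_setOf_sigma_fin_eq (d := fun l ↦ (l + 2 * m - 1).choose (2 * m)) (μ := fun l : ℕ ↦ (l : ℝ) * (l + 2 * m))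
    (natCast_mul_add_eq_zero_iff m hm)]
  simp only [zero_add, Nat.choose_eq_zero_of_lt (show 2 * m - 1 < 2 * m by omega)]

/-- **The Neumann hemisphere has exactly ONE zero mode** (`N(0) = C(2m, 2m) = 1`). [cite: FreitasMaoSalavessa2025, §1.3] -/
theorem ncard_setOf_neumannOddHemisphere_eq_zero (m : ℕ) (hm : 1 ≤ m) :
    {i : (Σ l : ℕ, Fin ((l + 2 * m).choose (2 * m))) | ((i.1 : ℝ) * (i.1 + 2 * m)) = 0}.ncard = 1 := by
  rw [ncard_setOf_sigma_fin_eq (d := fun l ↦ (l + 2 * m).choose (2 * m)) (μ := fun l : ℕ ↦ (l : ℝ) * (l + 2 * m))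
    (natCast_mul_add_eq_zero_iff m hm)]
  simp only [zero_add, Nat.choose_self]

/-! ### §3 The expansions: integer powers from the boundary trace (Zagier ∕ Euler–Maclaurin), half-integer powers from the sphere -/

/-- **ODD POLYNOMIAL WEIGHTS ON THE INTEGER GRID TO ALL ORDERS**: for coefficients `q₀, …, q_{m−1}` and every `N`, as `t → 0⁺`,
`∑_{n≥0}(∑_{k<m} q_k n^{2k+1})e^{−tn²} − ∑_{k<m} q_k·k!/(2t^{k+1}) − ∑_{i<N}(∑_{k<m} q_k r_{k,i})tⁱ = O(t^N)`,
`r_{k,i} = (−1)^{i+1}B_{2(k+i+1)}/(2(k+i+1)·i!) = ((−1)ⁱ/i!)ζ(−2k−2i−1)` — row g41-#1 summed over the powers. [cite: Zagier2006Mellin,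
§4 Proposition 3 eq. (42)] -/
theorem isBigO_tsum_oddPoly_mul_exp_neg_mul_sq_sub (q : ℕ → ℝ) (m N : ℕ) :
    (fun t : ℝ ↦ ∑' n : ℕ, (∑ k ∈ Finset.range m, q k * (n : ℝ) ^ (2 * k + 1)) * rexp (-(t * ((n : ℝ)) ^ 2)) -
      ∑ k ∈ Finset.range m, q k * ((k.factorial : ℝ) / (2 * t ^ (k + 1))) -
      ∑ i ∈ Finset.range N, (∑ k ∈ Finset.range m, q k * ((-1 : ℝ) ^ (i + 1) * (bernoulli (2 * (k + i + 1)) : ℝ) /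
        (2 * ((k + i + 1 : ℕ) : ℝ) * (i.factorial : ℝ)))) * t ^ i) =O[𝓝[>] 0] fun t : ℝ ↦ t ^ N := by
  have h := IsBigO.sum (s := Finset.range m) fun k _ ↦
    (isBigO_tsum_pow_mul_exp_neg_mul_sq_sub k N).const_mul_left (q k)
  refine h.congr' ?_ EventuallyEq.rfl
  filter_upwards [self_mem_nhdsWithin] with t (ht : 0 < t)
  have hsum : ∀ k ∈ Finset.range m, Summable fun n : ℕ ↦ q k * ((n : ℝ) ^ (2 * k + 1) * rexp (-(t * ((n : ℝ)) ^ 2))) :=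
    fun k _ ↦ (summable_pow_mul_exp_neg_mul_sq (2 * k + 1) ht).mul_left (q k)
  have e1 : ∑' n : ℕ, (∑ k ∈ Finset.range m, q k * (n : ℝ) ^ (2 * k + 1)) * rexp (-(t * ((n : ℝ)) ^ 2)) =
      ∑ k ∈ Finset.range m, q k * ∑' n : ℕ, (n : ℝ) ^ (2 * k + 1) * rexp (-(t * ((n : ℝ)) ^ 2)) := by
    have step : ∀ n : ℕ, (∑ k ∈ Finset.range m, q k * (n : ℝ) ^ (2 * k + 1)) * rexp (-(t * ((n : ℝ)) ^ 2)) =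
        ∑ k ∈ Finset.range m, q k * ((n : ℝ) ^ (2 * k + 1) * rexp (-(t * ((n : ℝ)) ^ 2))) := by
      intro n
      rw [Finset.sum_mul]
      exact Finset.sum_congr rfl fun k _ ↦ by ring
    rw [tsum_congr step, Summable.tsum_finsetSum hsum]
    exact Finset.sum_congr rfl fun k _ ↦ tsum_mul_left
  have e2 : ∑ i ∈ Finset.range N, (∑ k ∈ Finset.range m, q k * ((-1 : ℝ) ^ (i + 1) * (bernoulli (2 * (k + i + 1)) : ℝ) /
        (2 * ((k + i + 1 : ℕ) : ℝ) * (i.factorial : ℝ)))) * t ^ i =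
      ∑ k ∈ Finset.range m, q k * ∑ i ∈ Finset.range N, ((-1 : ℝ) ^ (i + 1) * (bernoulli (2 * (k + i + 1)) : ℝ) /
        (2 * ((k + i + 1 : ℕ) : ℝ) * (i.factorial : ℝ))) * t ^ i := by
    simp only [Finset.sum_mul, Finset.mul_sum]
    rw [Finset.sum_comm]
    exact Finset.sum_congr rfl fun k _ ↦ Finset.sum_congr rfl fun i _ ↦ by ring
  rw [e1, e2, ← Finset.sum_sub_distrib, ← Finset.sum_sub_distrib]
  exact Finset.sum_congr rfl fun k _ ↦ by ring

/-- **The boundary theta sum times `t^m`, collected into a single power series**: for every `N`,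
`t^m·∑_{n≥0}(∑_{k<m} B_{m,k}n^{2k+1})e^{−tn²} − ∑_{b<m+N+2} v_{m,b}t^b = O(t^{m+N+2})`, with the SINGULAR coefficients
`v_{m,b} = B_{m,m−1−b}·(m−1−b)!/2` (`b < m`, the integrals `I_f = k!/2`) and the REGULAR ones `v_{m,m+i} = ∑_{k<m} B_{m,k}r_{k,i}`
(the zeta values `bₙζ(−n)`). [cite: Zagier2006Mellin, §4 Proposition 3 eq. (42); Kirsten2001, §3.2 eq. (3.2.19)] -/
theorem isBigO_pow_mul_oddHemisphereTheta_sub (m N : ℕ) :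
    (fun t : ℝ ↦ t ^ m * ∑' n : ℕ, (∑ k ∈ Finset.range m, (C (1 / ((2 * m - 1).factorial : ℝ)) * ∏ i ∈ Finset.range (m - 1), (X - C (((i : ℝ) + 1) ^ 2))).coeff k * (n : ℝ) ^ (2 * k + 1)) * rexp (-(t * ((n : ℝ)) ^ 2)) -
      ∑ b ∈ Finset.range (m + N + 1 + 1), (if b < m then (C (1 / ((2 * m - 1).factorial : ℝ)) * ∏ i ∈ Finset.range (m - 1), (X - C (((i : ℝ) + 1) ^ 2))).coeff (m - 1 - b) * ((((m - 1 - b).factorial : ℕ) : ℝ) / 2)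
        else ∑ k ∈ Finset.range m, (C (1 / ((2 * m - 1).factorial : ℝ)) * ∏ i ∈ Finset.range (m - 1), (X - C (((i : ℝ) + 1) ^ 2))).coeff k * ((-1 : ℝ) ^ (b - m + 1) * (bernoulli (2 * (k + (b - m) + 1)) : ℝ) /
            (2 * ((k + (b - m) + 1 : ℕ) : ℝ) * ((b - m).factorial : ℝ)))) * t ^ b) =O[𝓝[>] 0] fun t : ℝ ↦ t ^ (m + N + 1 + 1) := by
  rw [show m + N + 1 + 1 = m + (N + 2) by ring]
  set p : ℝ[X] := (C (1 / ((2 * m - 1).factorial : ℝ)) * ∏ i ∈ Finset.range (m - 1), (X - C (((i : ℝ) + 1) ^ 2))) with hp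
  have h := (isBigO_refl (fun t : ℝ ↦ t ^ m) (𝓝[>] (0 : ℝ))).mul
    (isBigO_tsum_oddPoly_mul_exp_neg_mul_sq_sub (fun k ↦ p.coeff k) m (N + 2))
  have h' := h.congr_right (g₂ := fun t : ℝ ↦ t ^ (m + (N + 2))) (fun t ↦ by ring)
  refine h'.congr' ?_ EventuallyEq.rfl
  filter_upwards [self_mem_nhdsWithin] with t (ht : 0 < t)
  have ht0 : t ≠ 0 := ht.ne'
  -- the singular part: `t^m·∑_k p_k k!/(2t^{k+1}) = ∑_{b<m} v_b t^b` (reflect `b = m−1−k`)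
  have hA : t ^ m * ∑ k ∈ Finset.range m, p.coeff k * ((k.factorial : ℝ) / (2 * t ^ (k + 1))) =
      ∑ b ∈ Finset.range m, (if b < m then p.coeff (m - 1 - b) * ((((m - 1 - b).factorial : ℕ) : ℝ) / 2)
        else ∑ k ∈ Finset.range m, p.coeff k * ((-1 : ℝ) ^ (b - m + 1) * (bernoulli (2 * (k + (b - m) + 1)) : ℝ) /
            (2 * ((k + (b - m) + 1 : ℕ) : ℝ) * ((b - m).factorial : ℝ)))) * t ^ b := by
    rw [Finset.mul_sum, eq_comm, ← Finset.sum_range_reflect]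
    refine Finset.sum_congr rfl fun j hj ↦ ?_
    have hj' : j < m := Finset.mem_range.mp hj
    rw [if_pos (by omega : m - 1 - j < m), show m - 1 - (m - 1 - j) = j by omega]
    have e : t ^ m = t ^ (m - 1 - j) * t ^ (j + 1) := by
      rw [← pow_add]; congr 1; omega
    rw [e]
    field_simp
  -- the regular part
  have hB : t ^ m * ∑ i ∈ Finset.range (N + 2), (∑ k ∈ Finset.range m, p.coeff k *
      ((-1 : ℝ) ^ (i + 1) * (bernoulli (2 * (k + i + 1)) : ℝ) / (2 * ((k + i + 1 : ℕ) : ℝ) * (i.factorial : ℝ)))) * t ^ i =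
      ∑ i ∈ Finset.range (N + 2), (if m + i < m then p.coeff (m - 1 - (m + i)) * ((((m - 1 - (m + i)).factorial : ℕ) : ℝ) / 2)
        else ∑ k ∈ Finset.range m, p.coeff k * ((-1 : ℝ) ^ (m + i - m + 1) * (bernoulli (2 * (k + (m + i - m) + 1)) : ℝ) /
            (2 * ((k + (m + i - m) + 1 : ℕ) : ℝ) * ((m + i - m).factorial : ℝ)))) * t ^ (m + i) := by
    rw [Finset.mul_sum]
    refine Finset.sum_congr rfl fun i _ ↦ ?_
    rw [if_neg (by omega : ¬ (m + i < m)), Nat.add_sub_cancel_left, pow_add]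
    ring
  conv_rhs => rw [Finset.sum_range_add]
  rw [mul_sub, mul_sub, hA, hB]
  ring

/-- A real polynomial minus its truncation below degree `N+1` is `O(t^{N+1})` at `0`. [folklore] -/
private theorem isBigO_eval_sub_sum_coeff (q : ℝ[X]) (N : ℕ) :
    (fun t : ℝ ↦ q.eval t - ∑ k ∈ Finset.range (N + 1), q.coeff k * t ^ k) =O[𝓝[>] 0]
      fun t : ℝ ↦ t ^ (N + 1) := by
  set Dp : ℝ[X] := q - ∑ k ∈ Finset.range (N + 1), C (q.coeff k) * X ^ k with hDp
  have hcoeff : ∀ d < N + 1, Dp.coeff d = 0 := by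
    intro d hd
    simp only [hDp, coeff_sub, finsetSum_coeff, coeff_C_mul_X_pow]
    rw [Finset.sum_ite_eq, if_pos (Finset.mem_range.mpr hd), sub_self]
  obtain ⟨r, hr⟩ := Polynomial.X_pow_dvd_iff.mpr hcoeff
  have hev : ∀ t : ℝ, q.eval t - ∑ k ∈ Finset.range (N + 1), q.coeff k * t ^ k = t ^ (N + 1) * r.eval t := by
    intro t
    have := congrArg (Polynomial.eval t) hr
    simp only [hDp, eval_sub, eval_finsetSum, eval_mul, eval_C, eval_pow, eval_X] at this
    rw [this]
  have hr1 : (fun t : ℝ ↦ r.eval t) =O[𝓝[>] 0] fun _ : ℝ ↦ (1 : ℝ) :=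
    ((r.continuous.tendsto 0).isBigO_one ℝ).mono nhdsWithin_le_nhds
  have h := (isBigO_refl (fun t : ℝ ↦ t ^ (N + 1)) (𝓝[>] (0 : ℝ))).mul hr1
  simp only [mul_one] at h
  exact h.congr' (Eventually.of_forall fun t ↦ (hev t).symm) EventuallyEq.rfl

/-- `e^{ct} − ∑_{i≤M} cⁱtⁱ/i! = O(t^{M+1})` at `0⁺`, for every real `c`. [folklore] -/
private theorem isBigO_exp_const_mul_sub_sum (c : ℝ) (M : ℕ) :
    (fun t : ℝ ↦ rexp (c * t) - ∑ i ∈ Finset.range (M + 1), c ^ i / (i.factorial : ℝ) * t ^ i) =O[𝓝[>] 0]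
      fun t : ℝ ↦ t ^ (M + 1) := by
  refine IsBigO.of_bound (|c| ^ (M + 1) * (((M + 2 : ℕ) : ℝ) / (((M + 1).factorial : ℝ) * ((M + 1 : ℕ) : ℝ)))) ?_
  have hδ : (0 : ℝ) < 1 / (|c| + 1) := by positivity
  filter_upwards [Ioc_mem_nhdsGT hδ] with t ht
  have ht0 : 0 < t := ht.1
  have hct : |c * t| ≤ 1 := by
    rw [abs_mul, abs_of_pos ht0]
    have h1 : |c| * t ≤ |c| * (1 / (|c| + 1)) := mul_le_mul_of_nonneg_left ht.2 (abs_nonneg c)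
    have h2 : |c| * (1 / (|c| + 1)) ≤ 1 := by
      rw [mul_one_div, div_le_one (by positivity)]; linarith [abs_nonneg c]
    exact h1.trans h2
  have hb := Real.exp_bound hct (Nat.succ_pos M)
  simp only [Nat.succ_eq_add_one] at hb
  have e : ∑ i ∈ Finset.range (M + 1), c ^ i / (i.factorial : ℝ) * t ^ i = ∑ i ∈ Finset.range (M + 1), (c * t) ^ i / (i.factorial : ℝ) :=
    Finset.sum_congr rfl fun i _ ↦ by rw [mul_pow]; ring
  rw [Real.norm_eq_abs, Real.norm_of_nonneg (pow_nonneg ht0.le _), e]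
  refine hb.trans (le_of_eq ?_)
  rw [abs_mul, abs_of_pos ht0, mul_pow]
  push_cast
  ring

/-- **Cauchy product with an exponential.** If `Φ(t) − ∑_{j≤N+1} q_j tʲ = O(t^{N+2})` at `0⁺`, then
`e^{ct}Φ(t) − ∑_{k≤N} (∑_{a+b=k} (cᵃ/a!)q_b) tᵏ = O(t^{N+1})`. [folklore] -/
private theorem isBigO_exp_mul_sub_sum_antidiagonal (c : ℝ) (q : ℕ → ℝ) (Φ : ℝ → ℝ) (N : ℕ)
    (hΦ : (fun t : ℝ ↦ Φ t - ∑ j ∈ Finset.range (N + 1 + 1), q j * t ^ j) =O[𝓝[>] 0] fun t : ℝ ↦ t ^ (N + 1 + 1)) :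
    (fun t : ℝ ↦ rexp (c * t) * Φ t -
      ∑ k ∈ Finset.range (N + 1), (∑ x ∈ Finset.HasAntidiagonal.antidiagonal k, c ^ x.1 / (x.1.factorial : ℝ) * q x.2) * t ^ k)
      =O[𝓝[>] 0] fun t : ℝ ↦ t ^ (N + 1) := by
  set cc : ℕ → ℝ := fun i ↦ c ^ i / (i.factorial : ℝ) with hcc
  set d : ℕ → ℝ := fun k ↦ ∑ x ∈ Finset.HasAntidiagonal.antidiagonal k, cc x.1 * q x.2 with hd
  set P : ℝ[X] := ∑ i ∈ Finset.range (N + 1 + 1), C (cc i) * X ^ i with hP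
  set Q : ℝ[X] := ∑ j ∈ Finset.range (N + 1 + 1), C (q j) * X ^ j with hQ
  have hPev : ∀ t : ℝ, P.eval t = ∑ i ∈ Finset.range (N + 1 + 1), cc i * t ^ i := fun t ↦ by
    simp only [hP, eval_finsetSum, eval_mul, eval_C, eval_pow, eval_X]
  have hQev : ∀ t : ℝ, Q.eval t = ∑ j ∈ Finset.range (N + 1 + 1), q j * t ^ j := fun t ↦ by
    simp only [hQ, eval_finsetSum, eval_mul, eval_C, eval_pow, eval_X]
  have hPc : ∀ i, P.coeff i = if i ∈ Finset.range (N + 1 + 1) then cc i else 0 := fun i ↦ by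
    simp only [hP, finsetSum_coeff, coeff_C_mul_X_pow]
    rw [Finset.sum_ite_eq]
  have hQc : ∀ j, Q.coeff j = if j ∈ Finset.range (N + 1 + 1) then q j else 0 := fun j ↦ by
    simp only [hQ, finsetSum_coeff, coeff_C_mul_X_pow]
    rw [Finset.sum_ite_eq]
  have hPQc : ∀ k < N + 1, (P * Q).coeff k = d k := by
    intro k hk
    rw [coeff_mul, hd]
    refine Finset.sum_congr rfl fun x hx ↦ ?_
    rw [Finset.HasAntidiagonal.mem_antidiagonal] at hx
    rw [hPc, hQc, if_pos (Finset.mem_range.mpr (by omega)), if_pos (Finset.mem_range.mpr (by omega))]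
  have h1 : (fun t : ℝ ↦ rexp (c * t) - P.eval t) =O[𝓝[>] 0] fun t : ℝ ↦ t ^ (N + 1 + 1) :=
    (isBigO_exp_const_mul_sub_sum c (N + 1)).congr' (Eventually.of_forall fun t ↦ by simp only [hPev, hcc]) EventuallyEq.rfl
  have h2 : (fun t : ℝ ↦ Φ t - Q.eval t) =O[𝓝[>] 0] fun t : ℝ ↦ t ^ (N + 1 + 1) :=
    hΦ.congr' (Eventually.of_forall fun t ↦ by simp only [hQev]) EventuallyEq.rfl
  have hE : (fun t : ℝ ↦ rexp (c * t)) =O[𝓝[>] 0] fun _ : ℝ ↦ (1 : ℝ) :=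
    (((by fun_prop : Continuous fun t : ℝ ↦ rexp (c * t)).tendsto 0).isBigO_one ℝ).mono nhdsWithin_le_nhds
  have hQ1 : (fun t : ℝ ↦ Q.eval t) =O[𝓝[>] 0] fun _ : ℝ ↦ (1 : ℝ) :=
    ((Q.continuous.tendsto 0).isBigO_one ℝ).mono nhdsWithin_le_nhds
  have h3 : (fun t : ℝ ↦ rexp (c * t) * Φ t - (P * Q).eval t) =O[𝓝[>] 0] fun t : ℝ ↦ t ^ (N + 1 + 1) := by
    have h := (hE.mul h2).add (hQ1.mul h1)
    simp only [one_mul] at h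
    refine h.congr' ?_ EventuallyEq.rfl
    filter_upwards with t
    rw [eval_mul]
    ring
  have h4 : (fun t : ℝ ↦ (P * Q).eval t - ∑ k ∈ Finset.range (N + 1), d k * t ^ k) =O[𝓝[>] 0]
      fun t : ℝ ↦ t ^ (N + 1) :=
    (isBigO_eval_sub_sum_coeff (P * Q) N).congr' (Eventually.of_forall fun t ↦ by
      simp only
      exact congrArg (fun x : ℝ ↦ (P * Q).eval t - x)
        (Finset.sum_congr rfl fun k hk ↦ by rw [hPQc k (Finset.mem_range.mp hk)])) EventuallyEq.rfl
  have h34 : (fun t : ℝ ↦ t ^ (N + 1 + 1)) =O[𝓝[>] 0] fun t : ℝ ↦ t ^ (N + 1) := by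
    refine IsBigO.of_bound 1 ?_
    filter_upwards [Ioc_mem_nhdsGT (zero_lt_one' ℝ)] with t ht
    rw [Real.norm_of_nonneg (pow_nonneg ht.1.le _), Real.norm_of_nonneg (pow_nonneg ht.1.le _), one_mul, pow_succ]
    exact mul_le_of_le_one_right (pow_nonneg ht.1.le _) ht.2
  have h := (h3.trans h34).add h4
  refine h.congr' ?_ EventuallyEq.rfl
  filter_upwards with t
  simp only [hd, hcc]
  ring

/-- **THE BOUNDARY TRACE TO ALL ORDERS — INTEGER POWERS ONLY: `E_m(t) − ∑_{n≤m+N} E_{m,n}t^{n−m} = O(t^{N+1})`,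
`E_{m,n} = ∑_{a+b=n}((m²)ᵃ/a!)·v_{m,b}`** (the Cauchy product of `e^{m²t}` with the collected series of
`isBigO_pow_mul_oddHemisphereTheta_sub`): McKean–Singer's `±¼√(4πt)·area(∂)/(4πt)^{m+½}` (`n = 0`) and ALL its successors — an
infinite asymptotic series with Bernoulli-number coefficients ("these are asymptotic expansions; the series do not converge in
general"). [cite: McKeanSinger1967, eq. (6) p. 45; Zagier2006Mellin, §4 Proposition 3 eq. (42); FreitasMaoSalavessa2025, §2.2] -/
theorem isBigO_oddHemisphere_boundary_expansion (m : ℕ) (hm : 1 ≤ m) (N : ℕ) :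
    (fun t : ℝ ↦ ∑' l : ℕ, (((l + 2 * m - 1).choose (2 * m - 1) : ℕ) : ℝ) * rexp (-(t * ((l : ℝ) * (l + 2 * m)))) -
      ∑ n : Fin (m + N + 1), (fun n : Fin (m + N + 1) ↦ (∑ x ∈ Finset.HasAntidiagonal.antidiagonal (n : ℕ), ((m : ℝ) ^ 2) ^ x.1 / (x.1.factorial : ℝ) *
        (if x.2 < m then (C (1 / ((2 * m - 1).factorial : ℝ)) * ∏ i ∈ Finset.range (m - 1), (X - C (((i : ℝ) + 1) ^ 2))).coeff (m - 1 - x.2) * ((((m - 1 - x.2).factorial : ℕ) : ℝ) / 2)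
        else ∑ k ∈ Finset.range m, (C (1 / ((2 * m - 1).factorial : ℝ)) * ∏ i ∈ Finset.range (m - 1), (X - C (((i : ℝ) + 1) ^ 2))).coeff k * ((-1 : ℝ) ^ (x.2 - m + 1) * (bernoulli (2 * (k + (x.2 - m) + 1)) : ℝ) /
            (2 * ((k + (x.2 - m) + 1 : ℕ) : ℝ) * ((x.2 - m).factorial : ℝ)))))) n * t ^ ((fun n : Fin (m + N + 1) ↦ ((n : ℕ) : ℝ) - m) n))
      =O[𝓝[>] 0] fun t : ℝ ↦ t ^ ((N : ℝ) + 1) := by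
  have hU := isBigO_pow_mul_oddHemisphereTheta_sub m N
  have hC := isBigO_exp_mul_sub_sum_antidiagonal ((m : ℝ) ^ 2) (fun b ↦ (if b < m then (C (1 / ((2 * m - 1).factorial : ℝ)) * ∏ i ∈ Finset.range (m - 1), (X - C (((i : ℝ) + 1) ^ 2))).coeff (m - 1 - b) * ((((m - 1 - b).factorial : ℕ) : ℝ) / 2)
        else ∑ k ∈ Finset.range m, (C (1 / ((2 * m - 1).factorial : ℝ)) * ∏ i ∈ Finset.range (m - 1), (X - C (((i : ℝ) + 1) ^ 2))).coeff k * ((-1 : ℝ) ^ (b - m + 1) * (bernoulli (2 * (k + (b - m) + 1)) : ℝ) /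
            (2 * ((k + (b - m) + 1 : ℕ) : ℝ) * ((b - m).factorial : ℝ)))))
    (fun t ↦ t ^ m * ∑' n : ℕ, (∑ k ∈ Finset.range m, (C (1 / ((2 * m - 1).factorial : ℝ)) * ∏ i ∈ Finset.range (m - 1), (X - C (((i : ℝ) + 1) ^ 2))).coeff k * (n : ℝ) ^ (2 * k + 1)) * rexp (-(t * ((n : ℝ)) ^ 2)))
    (m + N) hU
  have h3 := (isBigO_refl (fun t : ℝ ↦ t ^ (-(m : ℝ))) (𝓝[>] (0 : ℝ))).mul hC
  have h4 : (fun t : ℝ ↦ t ^ (-(m : ℝ)) * t ^ (m + N + 1)) =O[𝓝[>] 0] fun t : ℝ ↦ t ^ ((N : ℝ) + 1) := by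
    refine IsBigO.of_bound 1 ?_
    filter_upwards [self_mem_nhdsWithin] with t (ht : 0 < t)
    rw [one_mul, Real.norm_of_nonneg (by positivity), Real.norm_of_nonneg (by positivity),
      Real.rpow_neg ht.le, Real.rpow_natCast, show (N : ℝ) + 1 = ((N + 1 : ℕ) : ℝ) by push_cast; ring,
      Real.rpow_natCast, show t ^ (m + N + 1) = t ^ m * t ^ (N + 1) by rw [← pow_add]; ring_nf,
      inv_mul_cancel_left₀ (pow_ne_zero _ ht.ne')]
  refine (h3.trans h4).congr' ?_ EventuallyEq.rfl
  filter_upwards [self_mem_nhdsWithin] with t (ht : 0 < t)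
  have hpm : (t ^ m : ℝ) ≠ 0 := pow_ne_zero _ ht.ne'
  rw [(hasSum_oddHemisphere_boundary_multiplicity m hm ht).tsum_eq, Fin.sum_univ_eq_sum_range
    (fun n : ℕ ↦ (∑ x ∈ Finset.HasAntidiagonal.antidiagonal n, ((m : ℝ) ^ 2) ^ x.1 / (x.1.factorial : ℝ) *
        (if x.2 < m then (C (1 / ((2 * m - 1).factorial : ℝ)) * ∏ i ∈ Finset.range (m - 1), (X - C (((i : ℝ) + 1) ^ 2))).coeff (m - 1 - x.2) * ((((m - 1 - x.2).factorial : ℕ) : ℝ) / 2)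
        else ∑ k ∈ Finset.range m, (C (1 / ((2 * m - 1).factorial : ℝ)) * ∏ i ∈ Finset.range (m - 1), (X - C (((i : ℝ) + 1) ^ 2))).coeff k * ((-1 : ℝ) ^ (x.2 - m + 1) * (bernoulli (2 * (k + (x.2 - m) + 1)) : ℝ) /
            (2 * ((k + (x.2 - m) + 1 : ℕ) : ℝ) * ((x.2 - m).factorial : ℝ))))) * t ^ (((n : ℕ) : ℝ) - m)) (m + N + 1)]
  simp only [Real.rpow_sub ht, Real.rpow_natCast, Real.rpow_neg ht.le]
  rw [mul_sub, Finset.mul_sum]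
  congr 1
  · field_simp
  · exact Finset.sum_congr rfl fun n _ ↦ by field_simp

/-- The common core of both expansions: `½(Z_{S^{2m+1}}(t) + εE_m(t)) − ∑_{k ∈ (Fin(m+1)×Fin(N+m+1)) ⊕ Fin(m+N+1)}
[½·½q_{m,j}Γ(j+½)(m²)^r/r!·t^{r−j−½} | ε·½E_{m,n}t^{n−m}] = O(t^{N+½})` for every real `ε`. [cite: McKeanSinger1967, eq. (6)
p. 45; Berard1986, Ch. VII nº2 Theorem (ii)] -/
private theorem isBigO_half_oddSphere_add_mul_boundary_sub (m : ℕ) (hm : 1 ≤ m) (ε : ℝ) (N : ℕ) :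
    (fun t : ℝ ↦ 1 / 2 * ((∑' i : (Σ l : ℕ, Fin ((l + 2 * m).choose (2 * m) + (l + 2 * m - 1).choose (2 * m))), rexp (-(t * ((i.1 : ℝ) * (i.1 + 2 * m))))) +
        ε * ∑' l : ℕ, (((l + 2 * m - 1).choose (2 * m - 1) : ℕ) : ℝ) * rexp (-(t * ((l : ℝ) * (l + 2 * m))))) -
      ∑ k : (Fin (m + 1) × Fin (N + m + 1)) ⊕ Fin (m + N + 1), Sum.elim (fun k : Fin (m + 1) × Fin (N + m + 1) ↦ 1 / 2 * ((fun k : Fin (m + 1) × Fin (N + m + 1) ↦ 1 / 2 * (C (2 / (Nat.factorial (2 * m) : ℝ)) * X * ∏ i ∈ Finset.range (m - 1), (X - C (((i : ℝ) + 1) ^ 2))).coeff (k.1 : ℕ) * Real.Gamma (((k.1 : ℕ) : ℝ) + 1 / 2) * ((m : ℝ) ^ 2) ^ (k.2 : ℕ) / ((k.2 : ℕ).factorial : ℝ)) k))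
          (fun n : Fin (m + N + 1) ↦ ε * (∑ x ∈ Finset.HasAntidiagonal.antidiagonal (n : ℕ), ((m : ℝ) ^ 2) ^ x.1 / (x.1.factorial : ℝ) *
        (if x.2 < m then (C (1 / ((2 * m - 1).factorial : ℝ)) * ∏ i ∈ Finset.range (m - 1), (X - C (((i : ℝ) + 1) ^ 2))).coeff (m - 1 - x.2) * ((((m - 1 - x.2).factorial : ℕ) : ℝ) / 2)
        else ∑ k ∈ Finset.range m, (C (1 / ((2 * m - 1).factorial : ℝ)) * ∏ i ∈ Finset.range (m - 1), (X - C (((i : ℝ) + 1) ^ 2))).coeff k * ((-1 : ℝ) ^ (x.2 - m + 1) * (bernoulli (2 * (k + (x.2 - m) + 1)) : ℝ) /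
            (2 * ((k + (x.2 - m) + 1 : ℕ) : ℝ) * ((x.2 - m).factorial : ℝ))))) / 2) k * t ^ (Sum.elim (fun k : Fin (m + 1) × Fin (N + m + 1) ↦ ((k.2 : ℕ) : ℝ) - ((k.1 : ℕ) : ℝ) - 1 / 2) (fun n : Fin (m + N + 1) ↦ ((n : ℕ) : ℝ) - m) k)) =O[𝓝[>] 0] fun t : ℝ ↦ t ^ ((N : ℝ) + 1 / 2) := by
  have hS0 := isBigO_oddSphere_heatTrace_expansion m hm (N + m)
  have hS := hS0.congr_right (g₂ := fun t : ℝ ↦ t ^ ((N : ℝ) + 1 / 2)) (fun t ↦ by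
    congr 1
    push_cast
    ring)
  have hB0 := isBigO_oddHemisphere_boundary_expansion m hm N
  have h1 : (fun t : ℝ ↦ t ^ ((N : ℝ) + 1)) =O[𝓝[>] 0] fun t : ℝ ↦ t ^ ((N : ℝ) + 1 / 2) := by
    refine IsBigO.of_bound 1 ?_
    filter_upwards [Ioc_mem_nhdsGT (zero_lt_one' ℝ)] with t ht
    rw [Real.norm_of_nonneg (Real.rpow_nonneg ht.1.le _), Real.norm_of_nonneg (Real.rpow_nonneg ht.1.le _), one_mul]
    exact Real.rpow_le_rpow_of_exponent_ge ht.1 ht.2 (by linarith)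
  have hB := hB0.trans h1
  have h := (hS.const_mul_left (1 / 2)).add (hB.const_mul_left (ε / 2))
  refine h.congr' ?_ EventuallyEq.rfl
  filter_upwards [self_mem_nhdsWithin] with t (ht : 0 < t)
  rw [Fintype.sum_sum_type]
  simp only [Sum.elim_inl, Sum.elim_inr]
  have e1 : ∀ k : Fin (m + 1) × Fin (N + m + 1),
      1 / 2 * (1 / 2 * (C (2 / (Nat.factorial (2 * m) : ℝ)) * X * ∏ i ∈ Finset.range (m - 1), (X - C (((i : ℝ) + 1) ^ 2))).coeff (k.1 : ℕ) * Real.Gamma (((k.1 : ℕ) : ℝ) + 1 / 2) * ((m : ℝ) ^ 2) ^ (k.2 : ℕ) / ((k.2 : ℕ).factorial : ℝ)) *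
        t ^ (((k.2 : ℕ) : ℝ) - ((k.1 : ℕ) : ℝ) - 1 / 2) =
      1 / 2 * ((1 / 2 * (C (2 / (Nat.factorial (2 * m) : ℝ)) * X * ∏ i ∈ Finset.range (m - 1), (X - C (((i : ℝ) + 1) ^ 2))).coeff (k.1 : ℕ) * Real.Gamma (((k.1 : ℕ) : ℝ) + 1 / 2) * ((m : ℝ) ^ 2) ^ (k.2 : ℕ) / ((k.2 : ℕ).factorial : ℝ)) *
        t ^ (((k.2 : ℕ) : ℝ) - ((k.1 : ℕ) : ℝ) - 1 / 2)) := fun k ↦ by ring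
  have e2 : ∀ n : Fin (m + N + 1), ε * (∑ x ∈ Finset.HasAntidiagonal.antidiagonal (n : ℕ), ((m : ℝ) ^ 2) ^ x.1 / (x.1.factorial : ℝ) *
        (if x.2 < m then (C (1 / ((2 * m - 1).factorial : ℝ)) * ∏ i ∈ Finset.range (m - 1), (X - C (((i : ℝ) + 1) ^ 2))).coeff (m - 1 - x.2) * ((((m - 1 - x.2).factorial : ℕ) : ℝ) / 2)
        else ∑ k ∈ Finset.range m, (C (1 / ((2 * m - 1).factorial : ℝ)) * ∏ i ∈ Finset.range (m - 1), (X - C (((i : ℝ) + 1) ^ 2))).coeff k * ((-1 : ℝ) ^ (x.2 - m + 1) * (bernoulli (2 * (k + (x.2 - m) + 1)) : ℝ) /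
            (2 * ((k + (x.2 - m) + 1 : ℕ) : ℝ) * ((x.2 - m).factorial : ℝ))))) / 2 * t ^ (((n : ℕ) : ℝ) - m) =
      ε / 2 * ((∑ x ∈ Finset.HasAntidiagonal.antidiagonal (n : ℕ), ((m : ℝ) ^ 2) ^ x.1 / (x.1.factorial : ℝ) *
        (if x.2 < m then (C (1 / ((2 * m - 1).factorial : ℝ)) * ∏ i ∈ Finset.range (m - 1), (X - C (((i : ℝ) + 1) ^ 2))).coeff (m - 1 - x.2) * ((((m - 1 - x.2).factorial : ℕ) : ℝ) / 2)
        else ∑ k ∈ Finset.range m, (C (1 / ((2 * m - 1).factorial : ℝ)) * ∏ i ∈ Finset.range (m - 1), (X - C (((i : ℝ) + 1) ^ 2))).coeff k * ((-1 : ℝ) ^ (x.2 - m + 1) * (bernoulli (2 * (k + (x.2 - m) + 1)) : ℝ) /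
            (2 * ((k + (x.2 - m) + 1 : ℕ) : ℝ) * ((x.2 - m).factorial : ℝ))))) * t ^ (((n : ℕ) : ℝ) - m)) := fun n ↦ by ring
  simp only [e1, e2, ← Finset.mul_sum]
  ring

/-- **THE DIRICHLET HEMISPHERE `S^{2m+1}_+` TO ALL ORDERS, EVERY `m ≥ 1`:
`Z_D(t) − ∑_{k ∈ (Fin(m+1)×Fin(N+m+1)) ⊕ Fin(m+N+1)} [¼q_{m,j}Γ(j+½)(m²)^r/r!·t^{r−j−½} | −½E_{m,n}t^{n−m}] = O(t^{N+½})`** — the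
half-integer powers are HALF the (finitely many) invariants of `S^{2m+1}` (row g39-#2), the integer powers `−½E_{m,n}` come from
the boundary (`−½E_{m,0}t^{−m} = −¼√(4πt)·area(S^{2m})/(4πt)^{m+½}`): McKean–Singer's "(6) `(4πt)^{d/2}Z⁻ = the volume of D −
¼√(4πt) × the surface area of B + ⋯`" for `D = S^{2m+1}_+`, continued to all orders; `m = 1` is row g40-#4 (`√π/(8t^{3/2}) −
1/(4t) + √π/(8√t) − 5/24 + ⋯`). [cite: McKeanSinger1967, eq. (6) p. 45; FreitasMaoSalavessa2025, §2.2; Berard1986, Ch. VII nº2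
Theorem (ii); Zagier2006Mellin, §4 Proposition 3 eq. (42)] -/
theorem isBigO_dirichletOddHemisphere_heatTrace_expansion (m : ℕ) (hm : 1 ≤ m) (N : ℕ) :
    (fun t : ℝ ↦ ∑' i : (Σ l : ℕ, Fin ((l + 2 * m - 1).choose (2 * m))), rexp (-(t * ((i.1 : ℝ) * (i.1 + 2 * m)))) - ∑ k : (Fin (m + 1) × Fin (N + m + 1)) ⊕ Fin (m + N + 1), Sum.elim (fun k : Fin (m + 1) × Fin (N + m + 1) ↦ 1 / 2 * ((fun k : Fin (m + 1) × Fin (N + m + 1) ↦ 1 / 2 * (C (2 / (Nat.factorial (2 * m) : ℝ)) * X * ∏ i ∈ Finset.range (m - 1), (X - C (((i : ℝ) + 1) ^ 2))).coeff (k.1 : ℕ) * Real.Gamma (((k.1 : ℕ) : ℝ) + 1 / 2) * ((m : ℝ) ^ 2) ^ (k.2 : ℕ) / ((k.2 : ℕ).factorial : ℝ)) k))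
          (fun n : Fin (m + N + 1) ↦ (-1) * (∑ x ∈ Finset.HasAntidiagonal.antidiagonal (n : ℕ), ((m : ℝ) ^ 2) ^ x.1 / (x.1.factorial : ℝ) *
        (if x.2 < m then (C (1 / ((2 * m - 1).factorial : ℝ)) * ∏ i ∈ Finset.range (m - 1), (X - C (((i : ℝ) + 1) ^ 2))).coeff (m - 1 - x.2) * ((((m - 1 - x.2).factorial : ℕ) : ℝ) / 2)
        else ∑ k ∈ Finset.range m, (C (1 / ((2 * m - 1).factorial : ℝ)) * ∏ i ∈ Finset.range (m - 1), (X - C (((i : ℝ) + 1) ^ 2))).coeff k * ((-1 : ℝ) ^ (x.2 - m + 1) * (bernoulli (2 * (k + (x.2 - m) + 1)) : ℝ) /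
            (2 * ((k + (x.2 - m) + 1 : ℕ) : ℝ) * ((x.2 - m).factorial : ℝ))))) / 2) k * t ^ (Sum.elim (fun k : Fin (m + 1) × Fin (N + m + 1) ↦ ((k.2 : ℕ) : ℝ) - ((k.1 : ℕ) : ℝ) - 1 / 2) (fun n : Fin (m + N + 1) ↦ ((n : ℕ) : ℝ) - m) k)) =O[𝓝[>] 0] fun t : ℝ ↦ t ^ ((N : ℝ) + 1 / 2) := by
  refine (isBigO_half_oddSphere_add_mul_boundary_sub m hm (-1) N).congr' ?_ EventuallyEq.rfl
  filter_upwards [self_mem_nhdsWithin] with t (ht : 0 < t)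
  rw [(hasSum_dirichletOddHemisphere m hm ht).tsum_eq, tsum_oddSphere m hm ht,
    (hasSum_oddHemisphere_boundary_multiplicity m hm ht).tsum_eq]
  ring

/-- **THE NEUMANN HEMISPHERE `S^{2m+1}_+` TO ALL ORDERS, EVERY `m ≥ 1`** (McKean–Singer's (6) with the upper sign, `Z⁺`):
`Z_N(t) − ∑[¼q_{m,j}Γ(j+½)(m²)^r/r!·t^{r−j−½} | +½E_{m,n}t^{n−m}] = O(t^{N+½})`. [cite: McKeanSinger1967, eq. (6) p. 45;
FreitasMaoSalavessa2025, §1.3; Berard1986, Ch. VII nº2 Theorem (ii); Zagier2006Mellin, §4 Proposition 3 eq. (42)] -/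
theorem isBigO_neumannOddHemisphere_heatTrace_expansion (m : ℕ) (hm : 1 ≤ m) (N : ℕ) :
    (fun t : ℝ ↦ ∑' i : (Σ l : ℕ, Fin ((l + 2 * m).choose (2 * m))), rexp (-(t * ((i.1 : ℝ) * (i.1 + 2 * m)))) - ∑ k : (Fin (m + 1) × Fin (N + m + 1)) ⊕ Fin (m + N + 1), Sum.elim (fun k : Fin (m + 1) × Fin (N + m + 1) ↦ 1 / 2 * ((fun k : Fin (m + 1) × Fin (N + m + 1) ↦ 1 / 2 * (C (2 / (Nat.factorial (2 * m) : ℝ)) * X * ∏ i ∈ Finset.range (m - 1), (X - C (((i : ℝ) + 1) ^ 2))).coeff (k.1 : ℕ) * Real.Gamma (((k.1 : ℕ) : ℝ) + 1 / 2) * ((m : ℝ) ^ 2) ^ (k.2 : ℕ) / ((k.2 : ℕ).factorial : ℝ)) k))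
          (fun n : Fin (m + N + 1) ↦ 1 * (∑ x ∈ Finset.HasAntidiagonal.antidiagonal (n : ℕ), ((m : ℝ) ^ 2) ^ x.1 / (x.1.factorial : ℝ) *
        (if x.2 < m then (C (1 / ((2 * m - 1).factorial : ℝ)) * ∏ i ∈ Finset.range (m - 1), (X - C (((i : ℝ) + 1) ^ 2))).coeff (m - 1 - x.2) * ((((m - 1 - x.2).factorial : ℕ) : ℝ) / 2)
        else ∑ k ∈ Finset.range m, (C (1 / ((2 * m - 1).factorial : ℝ)) * ∏ i ∈ Finset.range (m - 1), (X - C (((i : ℝ) + 1) ^ 2))).coeff k * ((-1 : ℝ) ^ (x.2 - m + 1) * (bernoulli (2 * (k + (x.2 - m) + 1)) : ℝ) /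
            (2 * ((k + (x.2 - m) + 1 : ℕ) : ℝ) * ((x.2 - m).factorial : ℝ))))) / 2) k * t ^ (Sum.elim (fun k : Fin (m + 1) × Fin (N + m + 1) ↦ ((k.2 : ℕ) : ℝ) - ((k.1 : ℕ) : ℝ) - 1 / 2) (fun n : Fin (m + N + 1) ↦ ((n : ℕ) : ℝ) - m) k)) =O[𝓝[>] 0] fun t : ℝ ↦ t ^ ((N : ℝ) + 1 / 2) := by
  refine (isBigO_half_oddSphere_add_mul_boundary_sub m hm 1 N).congr' ?_ EventuallyEq.rfl
  filter_upwards [self_mem_nhdsWithin] with t (ht : 0 < t)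
  rw [(hasSum_neumannOddHemisphere m hm ht).tsum_eq, tsum_oddSphere m hm ht,
    (hasSum_oddHemisphere_boundary_multiplicity m hm ht).tsum_eq]
  ring

/-! ### §4 The boundary coefficients: `E_{m,0} = (m−1)!/(2(2m−1)!)` (McKean–Singer's `¼√(4π)(4π)^{−(m+½)}|S^{2m}|` doubled), `m = 1` -/

/-- **THE LEADING BOUNDARY COEFFICIENT `E_{m,0} = v_{m,0} = B_{m,m−1}·(m−1)!/2 = (m−1)!/(2(2m−1)!)`** (`B_{m,m−1} = 1/(2m−1)!`);
`m = 1`: `½`, `m = 2`: `1/12`. [cite: McKeanSinger1967, eq. (6) p. 45; Kirsten2001, §3.2 eq. (3.2.19)] -/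
theorem oddHemisphere_boundaryCoeff_zero (m : ℕ) (hm : 1 ≤ m) :
    (∑ x ∈ Finset.HasAntidiagonal.antidiagonal 0, ((m : ℝ) ^ 2) ^ x.1 / (x.1.factorial : ℝ) *
        (if x.2 < m then (C (1 / ((2 * m - 1).factorial : ℝ)) * ∏ i ∈ Finset.range (m - 1), (X - C (((i : ℝ) + 1) ^ 2))).coeff (m - 1 - x.2) * ((((m - 1 - x.2).factorial : ℕ) : ℝ) / 2)
        else ∑ k ∈ Finset.range m, (C (1 / ((2 * m - 1).factorial : ℝ)) * ∏ i ∈ Finset.range (m - 1), (X - C (((i : ℝ) + 1) ^ 2))).coeff k * ((-1 : ℝ) ^ (x.2 - m + 1) * (bernoulli (2 * (k + (x.2 - m) + 1)) : ℝ) /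
            (2 * ((k + (x.2 - m) + 1 : ℕ) : ℝ) * ((x.2 - m).factorial : ℝ))))) = ((m - 1).factorial : ℝ) / (2 * ((2 * m - 1).factorial : ℝ)) := by
  rw [Finset.Nat.antidiagonal_zero, Finset.sum_singleton]
  simp only [if_pos (show 0 < m by omega), Nat.sub_zero, pow_zero, Nat.factorial_zero, Nat.cast_one, div_one, one_mul,
    coeff_oddHemisphere_poly_top]
  have hf : ((2 * m - 1).factorial : ℝ) ≠ 0 := by positivity
  field_simp

/-- **McKEAN–SINGER'S BOUNDARY TERM FOR `S^{2m+1}_±`: `½E_{m,0} = ¼·(4π)^{1/2}·(4π)^{−(m+½)}·|S^{2m}|`, `|S^{2m}| = 2π^{m+½}/Γ(m+½)`**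
("`(4πt)^{d/2}Z± = vol D ± ¼√(4πt) × the surface area of B + ⋯`", `B = ∂S^{2m+1}_+ = S^{2m}`; "`|S^d| = 2π^{(d+1)/2}/Γ((d+1)/2)`").
[cite: McKeanSinger1967, eq. (6) p. 45; Kirsten2001, §4.2 (volume of `S^d`)] -/
theorem oddHemisphere_boundaryCoeff_zero_eq_area (m : ℕ) (hm : 1 ≤ m) :
    (∑ x ∈ Finset.HasAntidiagonal.antidiagonal 0, ((m : ℝ) ^ 2) ^ x.1 / (x.1.factorial : ℝ) *
        (if x.2 < m then (C (1 / ((2 * m - 1).factorial : ℝ)) * ∏ i ∈ Finset.range (m - 1), (X - C (((i : ℝ) + 1) ^ 2))).coeff (m - 1 - x.2) * ((((m - 1 - x.2).factorial : ℕ) : ℝ) / 2)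
        else ∑ k ∈ Finset.range m, (C (1 / ((2 * m - 1).factorial : ℝ)) * ∏ i ∈ Finset.range (m - 1), (X - C (((i : ℝ) + 1) ^ 2))).coeff k * ((-1 : ℝ) ^ (x.2 - m + 1) * (bernoulli (2 * (k + (x.2 - m) + 1)) : ℝ) /
            (2 * ((k + (x.2 - m) + 1 : ℕ) : ℝ) * ((x.2 - m).factorial : ℝ))))) / 2 = 1 / 4 * (4 * π) ^ (1 / 2 : ℝ) * ((4 * π) ^ (-((m : ℝ) + 1 / 2)) * (2 * π ^ ((m : ℝ) + 1 / 2) / Real.Gamma ((m : ℝ) + 1 / 2))) := by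
  rw [oddHemisphere_boundaryCoeff_zero m hm]
  obtain ⟨M, rfl⟩ : ∃ M, m = M + 1 := ⟨m - 1, by omega⟩
  have hπ := Real.pi_pos
  have h4π : (0 : ℝ) < 4 * π := by positivity
  set r : ℝ := √π with hr
  have hr0 : 0 < r := Real.sqrt_pos.mpr hπ
  have hrr : π = r * r := (Real.mul_self_sqrt hπ.le).symm
  have h412 : (4 : ℝ) ^ (1 / 2 : ℝ) = 2 := by
    rw [show (4 : ℝ) = 2 ^ (2 : ℝ) by norm_num, ← Real.rpow_mul (by norm_num)]; norm_num
  -- `Γ(M+1+½) = (2M+1)‼√π/2^{M+1}`, `(2M+1)! = (2M+1)‼(2M)‼ = (2M+1)‼2^M M!`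
  have hG : Real.Gamma ((((M + 1 : ℕ)) : ℝ) + 1 / 2) = ((2 * (M + 1) - 1).doubleFactorial : ℝ) * r / 2 ^ (M + 1) := by
    rw [Real.Gamma_nat_add_half (M + 1), hr]
  have hfac : ((2 * (M + 1) - 1).factorial : ℝ) = ((2 * (M + 1) - 1).doubleFactorial : ℝ) * (2 ^ M * (M.factorial : ℝ)) := by
    rw [show 2 * (M + 1) - 1 = 2 * M + 1 by omega, Nat.factorial_eq_mul_doubleFactorial, Nat.doubleFactorial_two_mul]
    push_cast
    ring
  rw [show M + 1 - 1 = M by omega, hfac, hG, Real.mul_rpow (by norm_num) hπ.le, h412, Real.rpow_neg h4π.le,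
    Real.rpow_add h4π, Real.rpow_natCast, Real.mul_rpow (by norm_num) hπ.le, h412, Real.rpow_add hπ, Real.rpow_natCast,
    ← Real.sqrt_eq_rpow, ← hr, mul_pow]
  have hD : (0 : ℝ) < ((2 * (M + 1) - 1).doubleFactorial : ℝ) := by exact_mod_cast Nat.doubleFactorial_pos _
  have hMf : (0 : ℝ) < (M.factorial : ℝ) := by positivity
  have h2M : (0 : ℝ) < (2 : ℝ) ^ M := by positivity
  have h4M : (0 : ℝ) < (4 : ℝ) ^ (M + 1) := by positivity
  have hπM : (0 : ℝ) < π ^ (M + 1) := by positivity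
  rw [show (4 : ℝ) ^ (M + 1) = 2 ^ M * 2 ^ M * 4 by rw [pow_succ, ← mul_pow]; norm_num]
  field_simp
  ring

/-- `B₂ = 1/6`. [folklore] -/
private theorem bernoulli_two : _root_.bernoulli 2 = 1 / 6 := by
  rw [_root_.bernoulli_two]; norm_num

/-- `B₄ = −1/30`. [folklore] -/
private theorem bernoulli_four : _root_.bernoulli 4 = -1 / 30 := by
  rw [bernoulli_eq_bernoulli'_of_ne_one (by norm_num), bernoulli'_four]

/-- **`m = 1` RECOVERS ROW g40-#4 (`S³_±`): `E_{1,0} = ½`, `E_{1,1} = 5/12`, `E_{1,2} = 19/120`** (`B₁ = 1`: `E_1(t) = e^t∑_{n≥0}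
ne^{−tn²} = e^t(1/(2t) − 1/12 − t/120 − ⋯) = 1/(2t) + 5/12 + (19/120)t + ⋯`, i.e. `Z_{D/N}(S³_±) = ⋯ ∓ 1/(4t) ⋯ ∓ 5/24 ⋯ ∓
(19/240)t ⋯`). [cite: McKeanSinger1967, eq. (6) p. 45; Zagier2006Mellin, §4 Proposition 3 eq. (42) (`∑ ne^{−tn²} = 1/(2t) −
1/12 − t/120 − ⋯`)] -/
theorem oddHemisphere_one_boundaryCoeff : (∑ x ∈ Finset.HasAntidiagonal.antidiagonal 0, (((1 : ℕ) : ℝ) ^ 2) ^ x.1 / (x.1.factorial : ℝ) *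
        (if x.2 < (1 : ℕ) then (C (1 / ((2 * (1 : ℕ) - 1).factorial : ℝ)) * ∏ i ∈ Finset.range ((1 : ℕ) - 1), (X - C (((i : ℝ) + 1) ^ 2))).coeff ((1 : ℕ) - 1 - x.2) * (((((1 : ℕ) - 1 - x.2).factorial : ℕ) : ℝ) / 2)
        else ∑ k ∈ Finset.range (1 : ℕ), (C (1 / ((2 * (1 : ℕ) - 1).factorial : ℝ)) * ∏ i ∈ Finset.range ((1 : ℕ) - 1), (X - C (((i : ℝ) + 1) ^ 2))).coeff k * ((-1 : ℝ) ^ (x.2 - (1 : ℕ) + 1) * (bernoulli (2 * (k + (x.2 - (1 : ℕ)) + 1)) : ℝ) /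
            (2 * ((k + (x.2 - (1 : ℕ)) + 1 : ℕ) : ℝ) * ((x.2 - (1 : ℕ)).factorial : ℝ))))) = 1 / 2 ∧ (∑ x ∈ Finset.HasAntidiagonal.antidiagonal 1, (((1 : ℕ) : ℝ) ^ 2) ^ x.1 / (x.1.factorial : ℝ) *
        (if x.2 < (1 : ℕ) then (C (1 / ((2 * (1 : ℕ) - 1).factorial : ℝ)) * ∏ i ∈ Finset.range ((1 : ℕ) - 1), (X - C (((i : ℝ) + 1) ^ 2))).coeff ((1 : ℕ) - 1 - x.2) * (((((1 : ℕ) - 1 - x.2).factorial : ℕ) : ℝ) / 2)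
        else ∑ k ∈ Finset.range (1 : ℕ), (C (1 / ((2 * (1 : ℕ) - 1).factorial : ℝ)) * ∏ i ∈ Finset.range ((1 : ℕ) - 1), (X - C (((i : ℝ) + 1) ^ 2))).coeff k * ((-1 : ℝ) ^ (x.2 - (1 : ℕ) + 1) * (bernoulli (2 * (k + (x.2 - (1 : ℕ)) + 1)) : ℝ) /
            (2 * ((k + (x.2 - (1 : ℕ)) + 1 : ℕ) : ℝ) * ((x.2 - (1 : ℕ)).factorial : ℝ))))) = 5 / 12 ∧ (∑ x ∈ Finset.HasAntidiagonal.antidiagonal 2, (((1 : ℕ) : ℝ) ^ 2) ^ x.1 / (x.1.factorial : ℝ) *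
        (if x.2 < (1 : ℕ) then (C (1 / ((2 * (1 : ℕ) - 1).factorial : ℝ)) * ∏ i ∈ Finset.range ((1 : ℕ) - 1), (X - C (((i : ℝ) + 1) ^ 2))).coeff ((1 : ℕ) - 1 - x.2) * (((((1 : ℕ) - 1 - x.2).factorial : ℕ) : ℝ) / 2)
        else ∑ k ∈ Finset.range (1 : ℕ), (C (1 / ((2 * (1 : ℕ) - 1).factorial : ℝ)) * ∏ i ∈ Finset.range ((1 : ℕ) - 1), (X - C (((i : ℝ) + 1) ^ 2))).coeff k * ((-1 : ℝ) ^ (x.2 - (1 : ℕ) + 1) * (bernoulli (2 * (k + (x.2 - (1 : ℕ)) + 1)) : ℝ) /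
            (2 * ((k + (x.2 - (1 : ℕ)) + 1 : ℕ) : ℝ) * ((x.2 - (1 : ℕ)).factorial : ℝ))))) = 19 / 120 := by
  have hP : (C (1 / ((2 * (1 : ℕ) - 1).factorial : ℝ)) * ∏ i ∈ Finset.range ((1 : ℕ) - 1), (X - C (((i : ℝ) + 1) ^ 2))) = 1 := by
    rw [show (1 : ℕ) - 1 = 0 from rfl, Finset.prod_range_zero, mul_one, show 2 * (1 : ℕ) - 1 = 1 from rfl, Nat.factorial_one,
      Nat.cast_one, div_one, map_one]
  refine ⟨?_, ?_, ?_⟩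
  · rw [Finset.Nat.antidiagonal_zero, Finset.sum_singleton]
    simp only [hP]
    norm_num [Nat.factorial]
  · rw [Finset.Nat.sum_antidiagonal_succ, Finset.Nat.antidiagonal_zero, Finset.sum_singleton]
    simp only [Finset.sum_range_succ, Finset.sum_range_zero, zero_add, hP, coeff_one_zero]
    norm_num [Nat.factorial, bernoulli_two]
  · rw [Finset.Nat.sum_antidiagonal_succ, Finset.Nat.sum_antidiagonal_succ, Finset.Nat.antidiagonal_zero,
      Finset.sum_singleton]
    simp only [Finset.sum_range_succ, Finset.sum_range_zero, zero_add, hP, coeff_one_zero]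
    norm_num [Nat.factorial, bernoulli_two, bernoulli_four]

/-! ### §5 Consequences through the abstract heat-trace theory: the leading term, Weyl's law, `ζ_D(0) = −½E_{m,m}`,
`ζ_N(0) = ½E_{m,m} − 1`, the integer boundary pole `s = m` with residues `∓1/(4(2m−1)!)` -/

/-- The leading sphere exponent `−(m+½)` is attained exactly at `(j, r) = (m, 0)`. [folklore] -/
private theorem oddHemisphereSphereExponent_eq_neg_iff (m M : ℕ) (k : Fin (m + 1) × Fin (M + 1)) :
    ((k.2 : ℕ) : ℝ) - ((k.1 : ℕ) : ℝ) - 1 / 2 = -((m : ℝ) + 1 / 2) ↔ k = (Fin.last m, 0) := by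
  constructor
  · intro h
    have h1 : ((k.2 : ℕ) : ℝ) + m = ((k.1 : ℕ) : ℝ) := by linarith
    have h2 : (k.2 : ℕ) + m = (k.1 : ℕ) := by exact_mod_cast h1
    have hj := k.1.isLt
    refine Prod.ext (Fin.ext ?_) (Fin.ext ?_)
    · rw [Fin.val_last]; omega
    · rw [Fin.val_zero]; omega
  · rintro rfl
    rw [Fin.val_last, Fin.val_zero]
    push_cast
    ring

/-- No sphere exponent `r − j − ½` is an integer. [folklore] -/
private theorem oddHemisphereSphereExponent_ne_intCast (m M : ℕ) (k : Fin (m + 1) × Fin (M + 1)) (z : ℤ) :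
    ((k.2 : ℕ) : ℝ) - ((k.1 : ℕ) : ℝ) - 1 / 2 ≠ (z : ℝ) := by
  intro h
  have h2 : ((2 * ((k.2 : ℕ) : ℤ) - 2 * ((k.1 : ℕ) : ℤ) - 1 : ℤ) : ℝ) = ((2 * z : ℤ) : ℝ) := by push_cast; linarith
  have h3 := Int.cast_injective h2
  omega

/-- `r − j − ½ ≠ 0`. [folklore] -/
private theorem oddHemisphereSphereExponent_ne_zero (m M : ℕ) (k : Fin (m + 1) × Fin (M + 1)) :
    ((k.2 : ℕ) : ℝ) - ((k.1 : ℕ) : ℝ) - 1 / 2 ≠ 0 := by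
  simpa using oddHemisphereSphereExponent_ne_intCast m M k 0

/-- `r − j − ½ ≠ −m`. [folklore] -/
private theorem oddHemisphereSphereExponent_ne_neg (m M : ℕ) (k : Fin (m + 1) × Fin (M + 1)) :
    ((k.2 : ℕ) : ℝ) - ((k.1 : ℕ) : ℝ) - 1 / 2 ≠ -(m : ℝ) := by
  have h := oddHemisphereSphereExponent_ne_intCast m M k (-(m : ℤ))
  push_cast at h
  exact h

/-- Exponent bookkeeping on `Fin M`, integer powers: `n − m = x ↔ n = n₀` when `x + m = n₀ < M`. [folklore] -/
private theorem oddHemisphereExponent_eq_iff (m M : ℕ) {n₀ : ℕ} (hn : n₀ < M) (x : ℝ) (hx : x + m = n₀) (k : Fin M) :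
    ((k : ℕ) : ℝ) - m = x ↔ k = ⟨n₀, hn⟩ := by
  constructor
  · intro h
    ext
    have : ((k : ℕ) : ℝ) = (n₀ : ℝ) := by linarith
    exact_mod_cast this
  · rintro rfl
    simp only
    linarith

/-- An integer exponent is never `−(m+½)`. [folklore] -/
private theorem natCast_sub_ne_neg_add_half (n m : ℕ) : (n : ℝ) - m ≠ -((m : ℝ) + 1 / 2) := by
  intro h
  have h2 : ((2 * (n : ℤ) : ℤ) : ℝ) = ((-1 : ℤ) : ℝ) := by push_cast; linarith
  have h3 := Int.cast_injective h2
  omega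

/-- **THE LEADING HEAT INVARIANT OF THE DIRICHLET HEMISPHERE: `t^{m+½}·Z_D(t) → ½·Γ(m+½)/(2m)! = (4π)^{−(m+½)}·vol(S^{2m+1}_+)`**
(half of `S^{2m+1}`; the boundary term `t^{−m}` is invisible at this order). [cite: Berard1986, Ch. VII nº2 Theorem (ii) (`a₀ =
Vol`); McKeanSinger1967, eq. (6) p. 45] -/
theorem tendsto_rpow_mul_dirichletOddHemisphere_heatTrace (m : ℕ) (hm : 1 ≤ m) :
    Tendsto (fun t : ℝ ↦ t ^ ((m : ℝ) + 1 / 2) * ∑' i : (Σ l : ℕ, Fin ((l + 2 * m - 1).choose (2 * m))), rexp (-(t * ((i.1 : ℝ) * (i.1 + 2 * m))))) (𝓝[>] 0)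
      (𝓝 (Real.Gamma ((m : ℝ) + 1 / 2) / (Nat.factorial (2 * m) : ℝ) / 2)) := by
  have h := tendsto_rpow_mul_of_expansion (isBigO_dirichletOddHemisphere_heatTrace_expansion m hm 0) (ρ := (m : ℝ) + 1 / 2)
    (fun k ↦ by
      rcases k with k | n
      · have hj : ((k.1 : ℕ) : ℝ) ≤ m := by exact_mod_cast Nat.lt_succ_iff.mp k.1.isLt
        have hr : (0 : ℝ) ≤ ((k.2 : ℕ) : ℝ) := Nat.cast_nonneg _
        simp only [Sum.elim_inl]
        linarith
      · simp only [Sum.elim_inr]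
        linarith [((n : ℕ).cast_nonneg : (0 : ℝ) ≤ (n : ℕ))])
    (by push_cast; linarith)
  have e : (∑ k : (Fin (m + 1) × Fin (0 + m + 1)) ⊕ Fin (m + 0 + 1), if Sum.elim (fun k : Fin (m + 1) × Fin (0 + m + 1) ↦ ((k.2 : ℕ) : ℝ) - ((k.1 : ℕ) : ℝ) - 1 / 2) (fun n : Fin (m + 0 + 1) ↦ ((n : ℕ) : ℝ) - m) k = -((m : ℝ) + 1 / 2) then Sum.elim (fun k : Fin (m + 1) × Fin (0 + m + 1) ↦ 1 / 2 * ((fun k : Fin (m + 1) × Fin (0 + m + 1) ↦ 1 / 2 * (C (2 / (Nat.factorial (2 * m) : ℝ)) * X * ∏ i ∈ Finset.range (m - 1), (X - C (((i : ℝ) + 1) ^ 2))).coeff (k.1 : ℕ) * Real.Gamma (((k.1 : ℕ) : ℝ) + 1 / 2) * ((m : ℝ) ^ 2) ^ (k.2 : ℕ) / ((k.2 : ℕ).factorial : ℝ)) k))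
          (fun n : Fin (m + 0 + 1) ↦ (-1) * (∑ x ∈ Finset.HasAntidiagonal.antidiagonal (n : ℕ), ((m : ℝ) ^ 2) ^ x.1 / (x.1.factorial : ℝ) *
        (if x.2 < m then (C (1 / ((2 * m - 1).factorial : ℝ)) * ∏ i ∈ Finset.range (m - 1), (X - C (((i : ℝ) + 1) ^ 2))).coeff (m - 1 - x.2) * ((((m - 1 - x.2).factorial : ℕ) : ℝ) / 2)
        else ∑ k ∈ Finset.range m, (C (1 / ((2 * m - 1).factorial : ℝ)) * ∏ i ∈ Finset.range (m - 1), (X - C (((i : ℝ) + 1) ^ 2))).coeff k * ((-1 : ℝ) ^ (x.2 - m + 1) * (bernoulli (2 * (k + (x.2 - m) + 1)) : ℝ) /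
            (2 * ((k + (x.2 - m) + 1 : ℕ) : ℝ) * ((x.2 - m).factorial : ℝ))))) / 2) k else 0) =
      Real.Gamma ((m : ℝ) + 1 / 2) / (Nat.factorial (2 * m) : ℝ) / 2 := by
    rw [Fintype.sum_sum_type]
    simp only [Sum.elim_inl, Sum.elim_inr, oddHemisphereSphereExponent_eq_neg_iff, Finset.sum_ite_eq', Finset.mem_univ, if_true,
      Fin.val_last, Fin.val_zero, pow_zero, Nat.factorial_zero, Nat.cast_one, div_one, coeff_oddSphere_poly_self m hm,
      natCast_sub_ne_neg_add_half _ m, if_false, Finset.sum_const_zero, add_zero]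
    ring
  rw [e] at h
  exact h

/-- **THE LEADING HEAT INVARIANT OF THE NEUMANN HEMISPHERE: `t^{m+½}·Z_N(t) → ½·Γ(m+½)/(2m)!`**. [cite: Berard1986, Ch. VII nº2
Theorem (ii); McKeanSinger1967, eq. (6) p. 45] -/
theorem tendsto_rpow_mul_neumannOddHemisphere_heatTrace (m : ℕ) (hm : 1 ≤ m) :
    Tendsto (fun t : ℝ ↦ t ^ ((m : ℝ) + 1 / 2) * ∑' i : (Σ l : ℕ, Fin ((l + 2 * m).choose (2 * m))), rexp (-(t * ((i.1 : ℝ) * (i.1 + 2 * m))))) (𝓝[>] 0)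
      (𝓝 (Real.Gamma ((m : ℝ) + 1 / 2) / (Nat.factorial (2 * m) : ℝ) / 2)) := by
  have h := tendsto_rpow_mul_of_expansion (isBigO_neumannOddHemisphere_heatTrace_expansion m hm 0) (ρ := (m : ℝ) + 1 / 2)
    (fun k ↦ by
      rcases k with k | n
      · have hj : ((k.1 : ℕ) : ℝ) ≤ m := by exact_mod_cast Nat.lt_succ_iff.mp k.1.isLt
        have hr : (0 : ℝ) ≤ ((k.2 : ℕ) : ℝ) := Nat.cast_nonneg _
        simp only [Sum.elim_inl]
        linarith
      · simp only [Sum.elim_inr]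
        linarith [((n : ℕ).cast_nonneg : (0 : ℝ) ≤ (n : ℕ))])
    (by push_cast; linarith)
  have e : (∑ k : (Fin (m + 1) × Fin (0 + m + 1)) ⊕ Fin (m + 0 + 1), if Sum.elim (fun k : Fin (m + 1) × Fin (0 + m + 1) ↦ ((k.2 : ℕ) : ℝ) - ((k.1 : ℕ) : ℝ) - 1 / 2) (fun n : Fin (m + 0 + 1) ↦ ((n : ℕ) : ℝ) - m) k = -((m : ℝ) + 1 / 2) then Sum.elim (fun k : Fin (m + 1) × Fin (0 + m + 1) ↦ 1 / 2 * ((fun k : Fin (m + 1) × Fin (0 + m + 1) ↦ 1 / 2 * (C (2 / (Nat.factorial (2 * m) : ℝ)) * X * ∏ i ∈ Finset.range (m - 1), (X - C (((i : ℝ) + 1) ^ 2))).coeff (k.1 : ℕ) * Real.Gamma (((k.1 : ℕ) : ℝ) + 1 / 2) * ((m : ℝ) ^ 2) ^ (k.2 : ℕ) / ((k.2 : ℕ).factorial : ℝ)) k))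
          (fun n : Fin (m + 0 + 1) ↦ 1 * (∑ x ∈ Finset.HasAntidiagonal.antidiagonal (n : ℕ), ((m : ℝ) ^ 2) ^ x.1 / (x.1.factorial : ℝ) *
        (if x.2 < m then (C (1 / ((2 * m - 1).factorial : ℝ)) * ∏ i ∈ Finset.range (m - 1), (X - C (((i : ℝ) + 1) ^ 2))).coeff (m - 1 - x.2) * ((((m - 1 - x.2).factorial : ℕ) : ℝ) / 2)
        else ∑ k ∈ Finset.range m, (C (1 / ((2 * m - 1).factorial : ℝ)) * ∏ i ∈ Finset.range (m - 1), (X - C (((i : ℝ) + 1) ^ 2))).coeff k * ((-1 : ℝ) ^ (x.2 - m + 1) * (bernoulli (2 * (k + (x.2 - m) + 1)) : ℝ) /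
            (2 * ((k + (x.2 - m) + 1 : ℕ) : ℝ) * ((x.2 - m).factorial : ℝ))))) / 2) k else 0) =
      Real.Gamma ((m : ℝ) + 1 / 2) / (Nat.factorial (2 * m) : ℝ) / 2 := by
    rw [Fintype.sum_sum_type]
    simp only [Sum.elim_inl, Sum.elim_inr, oddHemisphereSphereExponent_eq_neg_iff, Finset.sum_ite_eq', Finset.mem_univ, if_true,
      Fin.val_last, Fin.val_zero, pow_zero, Nat.factorial_zero, Nat.cast_one, div_one, coeff_oddSphere_poly_self m hm,
      natCast_sub_ne_neg_add_half _ m, if_false, Finset.sum_const_zero, add_zero]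
    ring
  rw [e] at h
  exact h

/-- **WEYL'S LAW FOR THE DIRICHLET HEMISPHERE `S^{2m+1}_+`: `#{λ ≤ Λ}/Λ^{m+½} → 1/(2m+1)!`** — half the Weyl constant `2/(2m+1)!`
of `S^{2m+1}` (`vol(S^{2m+1}_+) = ½vol(S^{2m+1})`; "`c_w = (n!)^{2/n}`"); the boundary terms are invisible at Weyl order. [cite:
Berard1986, Ch. VII nº10 (ii) (11); FreitasMaoSalavessa2025, §2.2; McKeanSinger1967, eq. (6) p. 45] -/
theorem tendsto_ncard_dirichletOddHemisphere_le_div_rpow (m : ℕ) (hm : 1 ≤ m) :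
    Tendsto (fun Λ : ℝ ↦ (({i : (Σ l : ℕ, Fin ((l + 2 * m - 1).choose (2 * m))) | ((i.1 : ℝ) * (i.1 + 2 * m)) ≤ Λ}.ncard : ℕ) : ℝ) / Λ ^ ((m : ℝ) + 1 / 2)) atTop
      (𝓝 (1 / (Nat.factorial (2 * m + 1) : ℝ))) := by
  have hexp : (fun t : ℝ ↦ ∑' i : (Σ l : ℕ, Fin ((l + 2 * m - 1).choose (2 * m))), rexp (-(((i.1 : ℝ) * (i.1 + 2 * m)) * t)) - ∑ k : (Fin (m + 1) × Fin (0 + m + 1)) ⊕ Fin (m + 0 + 1), Sum.elim (fun k : Fin (m + 1) × Fin (0 + m + 1) ↦ 1 / 2 * ((fun k : Fin (m + 1) × Fin (0 + m + 1) ↦ 1 / 2 * (C (2 / (Nat.factorial (2 * m) : ℝ)) * X * ∏ i ∈ Finset.range (m - 1), (X - C (((i : ℝ) + 1) ^ 2))).coeff (k.1 : ℕ) * Real.Gamma (((k.1 : ℕ) : ℝ) + 1 / 2) * ((m : ℝ) ^ 2) ^ (k.2 : ℕ) / ((k.2 : ℕ).factorial : ℝ)) k))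
          (fun n : Fin (m + 0 + 1) ↦ (-1) * (∑ x ∈ Finset.HasAntidiagonal.antidiagonal (n : ℕ), ((m : ℝ) ^ 2) ^ x.1 / (x.1.factorial : ℝ) *
        (if x.2 < m then (C (1 / ((2 * m - 1).factorial : ℝ)) * ∏ i ∈ Finset.range (m - 1), (X - C (((i : ℝ) + 1) ^ 2))).coeff (m - 1 - x.2) * ((((m - 1 - x.2).factorial : ℕ) : ℝ) / 2)
        else ∑ k ∈ Finset.range m, (C (1 / ((2 * m - 1).factorial : ℝ)) * ∏ i ∈ Finset.range (m - 1), (X - C (((i : ℝ) + 1) ^ 2))).coeff k * ((-1 : ℝ) ^ (x.2 - m + 1) * (bernoulli (2 * (k + (x.2 - m) + 1)) : ℝ) /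
            (2 * ((k + (x.2 - m) + 1 : ℕ) : ℝ) * ((x.2 - m).factorial : ℝ))))) / 2) k * t ^ (Sum.elim (fun k : Fin (m + 1) × Fin (0 + m + 1) ↦ ((k.2 : ℕ) : ℝ) - ((k.1 : ℕ) : ℝ) - 1 / 2) (fun n : Fin (m + 0 + 1) ↦ ((n : ℕ) : ℝ) - m) k)) =O[𝓝[>] 0]
      fun t : ℝ ↦ t ^ (((0 : ℕ) : ℝ) + 1 / 2) := by
    refine (isBigO_dirichletOddHemisphere_heatTrace_expansion m hm 0).congr' ?_ EventuallyEq.rfl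
    filter_upwards with t
    congr 1
    exact tsum_congr fun i ↦ by rw [mul_comm]
  have hsum : ∀ t : ℝ, 0 < t → Summable fun i : (Σ l : ℕ, Fin ((l + 2 * m - 1).choose (2 * m))) ↦ rexp (-(((i.1 : ℝ) * (i.1 + 2 * m)) * t)) :=
    fun t ht ↦ (summable_dirichletOddHemisphere m hm ht).congr fun i ↦ by rw [mul_comm]
  have h := tendsto_ncard_le_div_rpow_of_expansion (μ := fun i : (Σ l : ℕ, Fin ((l + 2 * m - 1).choose (2 * m))) ↦ ((i.1 : ℝ) * (i.1 + 2 * m))) (ρ := (m : ℝ) + 1 / 2)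
    (fun i ↦ by positivity) hsum hexp
    (fun k ↦ by
      rcases k with k | n
      · have hj : ((k.1 : ℕ) : ℝ) ≤ m := by exact_mod_cast Nat.lt_succ_iff.mp k.1.isLt
        have hr : (0 : ℝ) ≤ ((k.2 : ℕ) : ℝ) := Nat.cast_nonneg _
        simp only [Sum.elim_inl]
        linarith
      · simp only [Sum.elim_inr]
        linarith [((n : ℕ).cast_nonneg : (0 : ℝ) ≤ (n : ℕ))])
    (by push_cast; linarith) (by positivity)
  have hG : Real.Gamma ((m : ℝ) + 1 / 2 + 1) = ((m : ℝ) + 1 / 2) * Real.Gamma ((m : ℝ) + 1 / 2) :=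
    Real.Gamma_add_one (by positivity)
  have hGpos : 0 < Real.Gamma ((m : ℝ) + 1 / 2) := Real.Gamma_pos_of_pos (by positivity)
  have e : (∑ k : (Fin (m + 1) × Fin (0 + m + 1)) ⊕ Fin (m + 0 + 1), if Sum.elim (fun k : Fin (m + 1) × Fin (0 + m + 1) ↦ ((k.2 : ℕ) : ℝ) - ((k.1 : ℕ) : ℝ) - 1 / 2) (fun n : Fin (m + 0 + 1) ↦ ((n : ℕ) : ℝ) - m) k = -((m : ℝ) + 1 / 2) then Sum.elim (fun k : Fin (m + 1) × Fin (0 + m + 1) ↦ 1 / 2 * ((fun k : Fin (m + 1) × Fin (0 + m + 1) ↦ 1 / 2 * (C (2 / (Nat.factorial (2 * m) : ℝ)) * X * ∏ i ∈ Finset.range (m - 1), (X - C (((i : ℝ) + 1) ^ 2))).coeff (k.1 : ℕ) * Real.Gamma (((k.1 : ℕ) : ℝ) + 1 / 2) * ((m : ℝ) ^ 2) ^ (k.2 : ℕ) / ((k.2 : ℕ).factorial : ℝ)) k))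
          (fun n : Fin (m + 0 + 1) ↦ (-1) * (∑ x ∈ Finset.HasAntidiagonal.antidiagonal (n : ℕ), ((m : ℝ) ^ 2) ^ x.1 / (x.1.factorial : ℝ) *
        (if x.2 < m then (C (1 / ((2 * m - 1).factorial : ℝ)) * ∏ i ∈ Finset.range (m - 1), (X - C (((i : ℝ) + 1) ^ 2))).coeff (m - 1 - x.2) * ((((m - 1 - x.2).factorial : ℕ) : ℝ) / 2)
        else ∑ k ∈ Finset.range m, (C (1 / ((2 * m - 1).factorial : ℝ)) * ∏ i ∈ Finset.range (m - 1), (X - C (((i : ℝ) + 1) ^ 2))).coeff k * ((-1 : ℝ) ^ (x.2 - m + 1) * (bernoulli (2 * (k + (x.2 - m) + 1)) : ℝ) /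
            (2 * ((k + (x.2 - m) + 1 : ℕ) : ℝ) * ((x.2 - m).factorial : ℝ))))) / 2) k else 0) /
      Real.Gamma ((m : ℝ) + 1 / 2 + 1) = 1 / (Nat.factorial (2 * m + 1) : ℝ) := by
    rw [Fintype.sum_sum_type]
    simp only [Sum.elim_inl, Sum.elim_inr, oddHemisphereSphereExponent_eq_neg_iff, Finset.sum_ite_eq', Finset.mem_univ, if_true,
      Fin.val_last, Fin.val_zero, pow_zero, Nat.factorial_zero, Nat.cast_one, div_one, coeff_oddSphere_poly_self m hm,
      natCast_sub_ne_neg_add_half _ m, if_false, Finset.sum_const_zero, add_zero, hG, Nat.factorial_succ]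
    have hf : (0 : ℝ) < (Nat.factorial (2 * m) : ℝ) := by exact_mod_cast Nat.factorial_pos _
    push_cast
    field_simp
  rw [e] at h
  exact h

/-- **WEYL'S LAW FOR THE NEUMANN HEMISPHERE: `#{λ ≤ Λ}/Λ^{m+½} → 1/(2m+1)!`**. [cite: Berard1986, Ch. VII nº10 (ii) (11);
FreitasMaoSalavessa2025, §1.3] -/
theorem tendsto_ncard_neumannOddHemisphere_le_div_rpow (m : ℕ) (hm : 1 ≤ m) :
    Tendsto (fun Λ : ℝ ↦ (({i : (Σ l : ℕ, Fin ((l + 2 * m).choose (2 * m))) | ((i.1 : ℝ) * (i.1 + 2 * m)) ≤ Λ}.ncard : ℕ) : ℝ) / Λ ^ ((m : ℝ) + 1 / 2)) atTop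
      (𝓝 (1 / (Nat.factorial (2 * m + 1) : ℝ))) := by
  have hexp : (fun t : ℝ ↦ ∑' i : (Σ l : ℕ, Fin ((l + 2 * m).choose (2 * m))), rexp (-(((i.1 : ℝ) * (i.1 + 2 * m)) * t)) - ∑ k : (Fin (m + 1) × Fin (0 + m + 1)) ⊕ Fin (m + 0 + 1), Sum.elim (fun k : Fin (m + 1) × Fin (0 + m + 1) ↦ 1 / 2 * ((fun k : Fin (m + 1) × Fin (0 + m + 1) ↦ 1 / 2 * (C (2 / (Nat.factorial (2 * m) : ℝ)) * X * ∏ i ∈ Finset.range (m - 1), (X - C (((i : ℝ) + 1) ^ 2))).coeff (k.1 : ℕ) * Real.Gamma (((k.1 : ℕ) : ℝ) + 1 / 2) * ((m : ℝ) ^ 2) ^ (k.2 : ℕ) / ((k.2 : ℕ).factorial : ℝ)) k))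
          (fun n : Fin (m + 0 + 1) ↦ 1 * (∑ x ∈ Finset.HasAntidiagonal.antidiagonal (n : ℕ), ((m : ℝ) ^ 2) ^ x.1 / (x.1.factorial : ℝ) *
        (if x.2 < m then (C (1 / ((2 * m - 1).factorial : ℝ)) * ∏ i ∈ Finset.range (m - 1), (X - C (((i : ℝ) + 1) ^ 2))).coeff (m - 1 - x.2) * ((((m - 1 - x.2).factorial : ℕ) : ℝ) / 2)
        else ∑ k ∈ Finset.range m, (C (1 / ((2 * m - 1).factorial : ℝ)) * ∏ i ∈ Finset.range (m - 1), (X - C (((i : ℝ) + 1) ^ 2))).coeff k * ((-1 : ℝ) ^ (x.2 - m + 1) * (bernoulli (2 * (k + (x.2 - m) + 1)) : ℝ) /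
            (2 * ((k + (x.2 - m) + 1 : ℕ) : ℝ) * ((x.2 - m).factorial : ℝ))))) / 2) k * t ^ (Sum.elim (fun k : Fin (m + 1) × Fin (0 + m + 1) ↦ ((k.2 : ℕ) : ℝ) - ((k.1 : ℕ) : ℝ) - 1 / 2) (fun n : Fin (m + 0 + 1) ↦ ((n : ℕ) : ℝ) - m) k)) =O[𝓝[>] 0]
      fun t : ℝ ↦ t ^ (((0 : ℕ) : ℝ) + 1 / 2) := by
    refine (isBigO_neumannOddHemisphere_heatTrace_expansion m hm 0).congr' ?_ EventuallyEq.rfl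
    filter_upwards with t
    congr 1
    exact tsum_congr fun i ↦ by rw [mul_comm]
  have hsum : ∀ t : ℝ, 0 < t → Summable fun i : (Σ l : ℕ, Fin ((l + 2 * m).choose (2 * m))) ↦ rexp (-(((i.1 : ℝ) * (i.1 + 2 * m)) * t)) :=
    fun t ht ↦ (summable_neumannOddHemisphere m hm ht).congr fun i ↦ by rw [mul_comm]
  have h := tendsto_ncard_le_div_rpow_of_expansion (μ := fun i : (Σ l : ℕ, Fin ((l + 2 * m).choose (2 * m))) ↦ ((i.1 : ℝ) * (i.1 + 2 * m))) (ρ := (m : ℝ) + 1 / 2)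
    (fun i ↦ by positivity) hsum hexp
    (fun k ↦ by
      rcases k with k | n
      · have hj : ((k.1 : ℕ) : ℝ) ≤ m := by exact_mod_cast Nat.lt_succ_iff.mp k.1.isLt
        have hr : (0 : ℝ) ≤ ((k.2 : ℕ) : ℝ) := Nat.cast_nonneg _
        simp only [Sum.elim_inl]
        linarith
      · simp only [Sum.elim_inr]
        linarith [((n : ℕ).cast_nonneg : (0 : ℝ) ≤ (n : ℕ))])
    (by push_cast; linarith) (by positivity)
  have hG : Real.Gamma ((m : ℝ) + 1 / 2 + 1) = ((m : ℝ) + 1 / 2) * Real.Gamma ((m : ℝ) + 1 / 2) :=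
    Real.Gamma_add_one (by positivity)
  have hGpos : 0 < Real.Gamma ((m : ℝ) + 1 / 2) := Real.Gamma_pos_of_pos (by positivity)
  have e : (∑ k : (Fin (m + 1) × Fin (0 + m + 1)) ⊕ Fin (m + 0 + 1), if Sum.elim (fun k : Fin (m + 1) × Fin (0 + m + 1) ↦ ((k.2 : ℕ) : ℝ) - ((k.1 : ℕ) : ℝ) - 1 / 2) (fun n : Fin (m + 0 + 1) ↦ ((n : ℕ) : ℝ) - m) k = -((m : ℝ) + 1 / 2) then Sum.elim (fun k : Fin (m + 1) × Fin (0 + m + 1) ↦ 1 / 2 * ((fun k : Fin (m + 1) × Fin (0 + m + 1) ↦ 1 / 2 * (C (2 / (Nat.factorial (2 * m) : ℝ)) * X * ∏ i ∈ Finset.range (m - 1), (X - C (((i : ℝ) + 1) ^ 2))).coeff (k.1 : ℕ) * Real.Gamma (((k.1 : ℕ) : ℝ) + 1 / 2) * ((m : ℝ) ^ 2) ^ (k.2 : ℕ) / ((k.2 : ℕ).factorial : ℝ)) k))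
          (fun n : Fin (m + 0 + 1) ↦ 1 * (∑ x ∈ Finset.HasAntidiagonal.antidiagonal (n : ℕ), ((m : ℝ) ^ 2) ^ x.1 / (x.1.factorial : ℝ) *
        (if x.2 < m then (C (1 / ((2 * m - 1).factorial : ℝ)) * ∏ i ∈ Finset.range (m - 1), (X - C (((i : ℝ) + 1) ^ 2))).coeff (m - 1 - x.2) * ((((m - 1 - x.2).factorial : ℕ) : ℝ) / 2)
        else ∑ k ∈ Finset.range m, (C (1 / ((2 * m - 1).factorial : ℝ)) * ∏ i ∈ Finset.range (m - 1), (X - C (((i : ℝ) + 1) ^ 2))).coeff k * ((-1 : ℝ) ^ (x.2 - m + 1) * (bernoulli (2 * (k + (x.2 - m) + 1)) : ℝ) /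
            (2 * ((k + (x.2 - m) + 1 : ℕ) : ℝ) * ((x.2 - m).factorial : ℝ))))) / 2) k else 0) /
      Real.Gamma ((m : ℝ) + 1 / 2 + 1) = 1 / (Nat.factorial (2 * m + 1) : ℝ) := by
    rw [Fintype.sum_sum_type]
    simp only [Sum.elim_inl, Sum.elim_inr, oddHemisphereSphereExponent_eq_neg_iff, Finset.sum_ite_eq', Finset.mem_univ, if_true,
      Fin.val_last, Fin.val_zero, pow_zero, Nat.factorial_zero, Nat.cast_one, div_one, coeff_oddSphere_poly_self m hm,
      natCast_sub_ne_neg_add_half _ m, if_false, Finset.sum_const_zero, add_zero, hG, Nat.factorial_succ]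
    have hf : (0 : ℝ) < (Nat.factorial (2 * m) : ℝ) := by exact_mod_cast Nat.factorial_pos _
    push_cast
    field_simp
  rw [e] at h
  exact h

/-- **`ζ_D(0) = −½E_{m,m}` FOR THE DIRICHLET HEMISPHERE `S^{2m+1}_+`** (order-`N` continuation, any `N`): the sphere exponents are
half-integers and never vanish (odd dimension: `ζ_{S^{2m+1}}(0) = −1` comes from the zero mode alone), so at `s = 0` only the
boundary's `t⁰`-coefficient `−½E_{m,m}` survives, and there is no zero mode. `m = 1`: `−5/24` (row g40-#4). [cite: Gilkey1995,
§1.10 Lemma 1.10.1; McKeanSinger1967, eq. (6) p. 45; FreitasMaoSalavessa2025, §2.2] -/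
theorem tendsto_dirichletOddHemisphereZeta_continuation_nhdsNE_zero (m : ℕ) (hm : 1 ≤ m) (N : ℕ) :
    Tendsto (fun s : ℂ ↦ (Complex.Gamma s)⁻¹ *
        (∑ k : (Fin (m + 1) × Fin (N + m + 1)) ⊕ Fin (m + N + 1), (((Sum.elim (fun k : Fin (m + 1) × Fin (N + m + 1) ↦ 1 / 2 * ((fun k : Fin (m + 1) × Fin (N + m + 1) ↦ 1 / 2 * (C (2 / (Nat.factorial (2 * m) : ℝ)) * X * ∏ i ∈ Finset.range (m - 1), (X - C (((i : ℝ) + 1) ^ 2))).coeff (k.1 : ℕ) * Real.Gamma (((k.1 : ℕ) : ℝ) + 1 / 2) * ((m : ℝ) ^ 2) ^ (k.2 : ℕ) / ((k.2 : ℕ).factorial : ℝ)) k))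
          (fun n : Fin (m + N + 1) ↦ (-1) * (∑ x ∈ Finset.HasAntidiagonal.antidiagonal (n : ℕ), ((m : ℝ) ^ 2) ^ x.1 / (x.1.factorial : ℝ) *
        (if x.2 < m then (C (1 / ((2 * m - 1).factorial : ℝ)) * ∏ i ∈ Finset.range (m - 1), (X - C (((i : ℝ) + 1) ^ 2))).coeff (m - 1 - x.2) * ((((m - 1 - x.2).factorial : ℕ) : ℝ) / 2)
        else ∑ k ∈ Finset.range m, (C (1 / ((2 * m - 1).factorial : ℝ)) * ∏ i ∈ Finset.range (m - 1), (X - C (((i : ℝ) + 1) ^ 2))).coeff k * ((-1 : ℝ) ^ (x.2 - m + 1) * (bernoulli (2 * (k + (x.2 - m) + 1)) : ℝ) /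
            (2 * ((k + (x.2 - m) + 1 : ℕ) : ℝ) * ((x.2 - m).factorial : ℝ))))) / 2) k : ℝ)) : ℂ) / (s + ((Sum.elim (fun k : Fin (m + 1) × Fin (N + m + 1) ↦ ((k.2 : ℕ) : ℝ) - ((k.1 : ℕ) : ℝ) - 1 / 2) (fun n : Fin (m + N + 1) ↦ ((n : ℕ) : ℝ) - m) k) : ℝ)) -
          ({i : (Σ l : ℕ, Fin ((l + 2 * m - 1).choose (2 * m))) | ((i.1 : ℝ) * (i.1 + 2 * m)) = 0}.ncard : ℂ) / s +
        mellin (fun t : ℝ ↦ ((∑' i : {i : (Σ l : ℕ, Fin ((l + 2 * m - 1).choose (2 * m))) | ((i.1 : ℝ) * (i.1 + 2 * m)) ≠ 0}, rexp (-(t * ((((i : (Σ l : ℕ, Fin ((l + 2 * m - 1).choose (2 * m))))).1 : ℝ) * (((i : (Σ l : ℕ, Fin ((l + 2 * m - 1).choose (2 * m))))).1 + 2 * m)))) : ℝ) : ℂ) -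
          (Ioc 0 1).indicator (fun t : ℝ ↦ ((∑ k : (Fin (m + 1) × Fin (N + m + 1)) ⊕ Fin (m + N + 1), Sum.elim (fun k : Fin (m + 1) × Fin (N + m + 1) ↦ 1 / 2 * ((fun k : Fin (m + 1) × Fin (N + m + 1) ↦ 1 / 2 * (C (2 / (Nat.factorial (2 * m) : ℝ)) * X * ∏ i ∈ Finset.range (m - 1), (X - C (((i : ℝ) + 1) ^ 2))).coeff (k.1 : ℕ) * Real.Gamma (((k.1 : ℕ) : ℝ) + 1 / 2) * ((m : ℝ) ^ 2) ^ (k.2 : ℕ) / ((k.2 : ℕ).factorial : ℝ)) k))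
          (fun n : Fin (m + N + 1) ↦ (-1) * (∑ x ∈ Finset.HasAntidiagonal.antidiagonal (n : ℕ), ((m : ℝ) ^ 2) ^ x.1 / (x.1.factorial : ℝ) *
        (if x.2 < m then (C (1 / ((2 * m - 1).factorial : ℝ)) * ∏ i ∈ Finset.range (m - 1), (X - C (((i : ℝ) + 1) ^ 2))).coeff (m - 1 - x.2) * ((((m - 1 - x.2).factorial : ℕ) : ℝ) / 2)
        else ∑ k ∈ Finset.range m, (C (1 / ((2 * m - 1).factorial : ℝ)) * ∏ i ∈ Finset.range (m - 1), (X - C (((i : ℝ) + 1) ^ 2))).coeff k * ((-1 : ℝ) ^ (x.2 - m + 1) * (bernoulli (2 * (k + (x.2 - m) + 1)) : ℝ) /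
            (2 * ((k + (x.2 - m) + 1 : ℕ) : ℝ) * ((x.2 - m).factorial : ℝ))))) / 2) k * t ^ (Sum.elim (fun k : Fin (m + 1) × Fin (N + m + 1) ↦ ((k.2 : ℕ) : ℝ) - ((k.1 : ℕ) : ℝ) - 1 / 2) (fun n : Fin (m + N + 1) ↦ ((n : ℕ) : ℝ) - m) k) : ℝ) : ℂ) - ({i : (Σ l : ℕ, Fin ((l + 2 * m - 1).choose (2 * m))) | ((i.1 : ℝ) * (i.1 + 2 * m)) = 0}.ncard : ℂ)) t) s)) (𝓝[≠] 0) (𝓝 ((((-1) * (∑ x ∈ Finset.HasAntidiagonal.antidiagonal m, ((m : ℝ) ^ 2) ^ x.1 / (x.1.factorial : ℝ) *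
        (if x.2 < m then (C (1 / ((2 * m - 1).factorial : ℝ)) * ∏ i ∈ Finset.range (m - 1), (X - C (((i : ℝ) + 1) ^ 2))).coeff (m - 1 - x.2) * ((((m - 1 - x.2).factorial : ℕ) : ℝ) / 2)
        else ∑ k ∈ Finset.range m, (C (1 / ((2 * m - 1).factorial : ℝ)) * ∏ i ∈ Finset.range (m - 1), (X - C (((i : ℝ) + 1) ^ 2))).coeff k * ((-1 : ℝ) ^ (x.2 - m + 1) * (bernoulli (2 * (k + (x.2 - m) + 1)) : ℝ) /
            (2 * ((k + (x.2 - m) + 1 : ℕ) : ℝ) * ((x.2 - m).factorial : ℝ))))) / 2 : ℝ)) : ℂ)) := by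
  have hβ : (0 : ℝ) < (N : ℝ) + 1 / 2 := by positivity
  have h := tendsto_continuation_nhdsNE_zero (μ := fun i : (Σ l : ℕ, Fin ((l + 2 * m - 1).choose (2 * m))) ↦ ((i.1 : ℝ) * (i.1 + 2 * m)))
    (fun i ↦ by positivity) (tendsto_dirichletOddHemisphere_cofinite_atTop m) (fun t ht ↦ summable_dirichletOddHemisphere m hm ht)
    (isBigO_dirichletOddHemisphere_heatTrace_expansion m hm N) hβ
  have e : ((∑ k : (Fin (m + 1) × Fin (N + m + 1)) ⊕ Fin (m + N + 1), if Sum.elim (fun k : Fin (m + 1) × Fin (N + m + 1) ↦ ((k.2 : ℕ) : ℝ) - ((k.1 : ℕ) : ℝ) - 1 / 2) (fun n : Fin (m + N + 1) ↦ ((n : ℕ) : ℝ) - m) k = 0 then (((Sum.elim (fun k : Fin (m + 1) × Fin (N + m + 1) ↦ 1 / 2 * ((fun k : Fin (m + 1) × Fin (N + m + 1) ↦ 1 / 2 * (C (2 / (Nat.factorial (2 * m) : ℝ)) * X * ∏ i ∈ Finset.range (m - 1), (X - C (((i : ℝ) + 1) ^ 2))).coeff (k.1 : ℕ) * Real.Gamma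 (((k.1 : ℕ) : ℝ) + 1 / 2) * ((m : ℝ) ^ 2) ^ (k.2 : ℕ) / ((k.2 : ℕ).factorial : ℝ)) k))
          (fun n : Fin (m + N + 1) ↦ (-1) * (∑ x ∈ Finset.HasAntidiagonal.antidiagonal (n : ℕ), ((m : ℝ) ^ 2) ^ x.1 / (x.1.factorial : ℝ) *
        (if x.2 < m then (C (1 / ((2 * m - 1).factorial : ℝ)) * ∏ i ∈ Finset.range (m - 1), (X - C (((i : ℝ) + 1) ^ 2))).coeff (m - 1 - x.2) * ((((m - 1 - x.2).factorial : ℕ) : ℝ) / 2)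
        else ∑ k ∈ Finset.range m, (C (1 / ((2 * m - 1).factorial : ℝ)) * ∏ i ∈ Finset.range (m - 1), (X - C (((i : ℝ) + 1) ^ 2))).coeff k * ((-1 : ℝ) ^ (x.2 - m + 1) * (bernoulli (2 * (k + (x.2 - m) + 1)) : ℝ) /
            (2 * ((k + (x.2 - m) + 1 : ℕ) : ℝ) * ((x.2 - m).factorial : ℝ))))) / 2) k : ℝ)) : ℂ) else 0) -
      ({i : (Σ l : ℕ, Fin ((l + 2 * m - 1).choose (2 * m))) | ((i.1 : ℝ) * (i.1 + 2 * m)) = 0}.ncard : ℂ)) = ((((-1) * (∑ x ∈ Finset.HasAntidiagonal.antidiagonal m, ((m : ℝ) ^ 2) ^ x.1 / (x.1.factorial : ℝ) *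
        (if x.2 < m then (C (1 / ((2 * m - 1).factorial : ℝ)) * ∏ i ∈ Finset.range (m - 1), (X - C (((i : ℝ) + 1) ^ 2))).coeff (m - 1 - x.2) * ((((m - 1 - x.2).factorial : ℕ) : ℝ) / 2)
        else ∑ k ∈ Finset.range m, (C (1 / ((2 * m - 1).factorial : ℝ)) * ∏ i ∈ Finset.range (m - 1), (X - C (((i : ℝ) + 1) ^ 2))).coeff k * ((-1 : ℝ) ^ (x.2 - m + 1) * (bernoulli (2 * (k + (x.2 - m) + 1)) : ℝ) /
            (2 * ((k + (x.2 - m) + 1 : ℕ) : ℝ) * ((x.2 - m).factorial : ℝ))))) / 2 : ℝ)) : ℂ) := by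
    rw [Fintype.sum_sum_type]
    simp only [Sum.elim_inl, Sum.elim_inr, oddHemisphereSphereExponent_ne_zero, if_false, Finset.sum_const_zero, zero_add,
      oddHemisphereExponent_eq_iff m (m + N + 1) (show m < m + N + 1 by omega) 0 (by ring), Finset.sum_ite_eq', Finset.mem_univ,
      if_true, ncard_setOf_dirichletOddHemisphere_eq_zero m hm, Nat.cast_zero, sub_zero]
  rw [e] at h
  exact h

/-- **`ζ_N(0) = ½E_{m,m} − 1` FOR THE NEUMANN HEMISPHERE** (one zero mode, the constants). `m = 1`: `5/24 − 1 = −19/24` (row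
g40-#4). [cite: Gilkey1995, §1.10 Lemma 1.10.1 and the remark on the positive semi-definite case; McKeanSinger1967, eq. (6) p. 45;
FreitasMaoSalavessa2025, §1.3] -/
theorem tendsto_neumannOddHemisphereZeta_continuation_nhdsNE_zero (m : ℕ) (hm : 1 ≤ m) (N : ℕ) :
    Tendsto (fun s : ℂ ↦ (Complex.Gamma s)⁻¹ *
        (∑ k : (Fin (m + 1) × Fin (N + m + 1)) ⊕ Fin (m + N + 1), (((Sum.elim (fun k : Fin (m + 1) × Fin (N + m + 1) ↦ 1 / 2 * ((fun k : Fin (m + 1) × Fin (N + m + 1) ↦ 1 / 2 * (C (2 / (Nat.factorial (2 * m) : ℝ)) * X * ∏ i ∈ Finset.range (m - 1), (X - C (((i : ℝ) + 1) ^ 2))).coeff (k.1 : ℕ) * Real.Gamma (((k.1 : ℕ) : ℝ) + 1 / 2) * ((m : ℝ) ^ 2) ^ (k.2 : ℕ) / ((k.2 : ℕ).factorial : ℝ)) k))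
          (fun n : Fin (m + N + 1) ↦ 1 * (∑ x ∈ Finset.HasAntidiagonal.antidiagonal (n : ℕ), ((m : ℝ) ^ 2) ^ x.1 / (x.1.factorial : ℝ) *
        (if x.2 < m then (C (1 / ((2 * m - 1).factorial : ℝ)) * ∏ i ∈ Finset.range (m - 1), (X - C (((i : ℝ) + 1) ^ 2))).coeff (m - 1 - x.2) * ((((m - 1 - x.2).factorial : ℕ) : ℝ) / 2)
        else ∑ k ∈ Finset.range m, (C (1 / ((2 * m - 1).factorial : ℝ)) * ∏ i ∈ Finset.range (m - 1), (X - C (((i : ℝ) + 1) ^ 2))).coeff k * ((-1 : ℝ) ^ (x.2 - m + 1) * (bernoulli (2 * (k + (x.2 - m) + 1)) : ℝ) /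
            (2 * ((k + (x.2 - m) + 1 : ℕ) : ℝ) * ((x.2 - m).factorial : ℝ))))) / 2) k : ℝ)) : ℂ) / (s + ((Sum.elim (fun k : Fin (m + 1) × Fin (N + m + 1) ↦ ((k.2 : ℕ) : ℝ) - ((k.1 : ℕ) : ℝ) - 1 / 2) (fun n : Fin (m + N + 1) ↦ ((n : ℕ) : ℝ) - m) k) : ℝ)) -
          ({i : (Σ l : ℕ, Fin ((l + 2 * m).choose (2 * m))) | ((i.1 : ℝ) * (i.1 + 2 * m)) = 0}.ncard : ℂ) / s +
        mellin (fun t : ℝ ↦ ((∑' i : {i : (Σ l : ℕ, Fin ((l + 2 * m).choose (2 * m))) | ((i.1 : ℝ) * (i.1 + 2 * m)) ≠ 0}, rexp (-(t * ((((i : (Σ l : ℕ, Fin ((l + 2 * m).choose (2 * m))))).1 : ℝ) * (((i : (Σ l : ℕ, Fin ((l + 2 * m).choose (2 * m))))).1 + 2 * m)))) : ℝ) : ℂ) -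
          (Ioc 0 1).indicator (fun t : ℝ ↦ ((∑ k : (Fin (m + 1) × Fin (N + m + 1)) ⊕ Fin (m + N + 1), Sum.elim (fun k : Fin (m + 1) × Fin (N + m + 1) ↦ 1 / 2 * ((fun k : Fin (m + 1) × Fin (N + m + 1) ↦ 1 / 2 * (C (2 / (Nat.factorial (2 * m) : ℝ)) * X * ∏ i ∈ Finset.range (m - 1), (X - C (((i : ℝ) + 1) ^ 2))).coeff (k.1 : ℕ) * Real.Gamma (((k.1 : ℕ) : ℝ) + 1 / 2) * ((m : ℝ) ^ 2) ^ (k.2 : ℕ) / ((k.2 : ℕ).factorial : ℝ)) k))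
          (fun n : Fin (m + N + 1) ↦ 1 * (∑ x ∈ Finset.HasAntidiagonal.antidiagonal (n : ℕ), ((m : ℝ) ^ 2) ^ x.1 / (x.1.factorial : ℝ) *
        (if x.2 < m then (C (1 / ((2 * m - 1).factorial : ℝ)) * ∏ i ∈ Finset.range (m - 1), (X - C (((i : ℝ) + 1) ^ 2))).coeff (m - 1 - x.2) * ((((m - 1 - x.2).factorial : ℕ) : ℝ) / 2)
        else ∑ k ∈ Finset.range m, (C (1 / ((2 * m - 1).factorial : ℝ)) * ∏ i ∈ Finset.range (m - 1), (X - C (((i : ℝ) + 1) ^ 2))).coeff k * ((-1 : ℝ) ^ (x.2 - m + 1) * (bernoulli (2 * (k + (x.2 - m) + 1)) : ℝ) /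
            (2 * ((k + (x.2 - m) + 1 : ℕ) : ℝ) * ((x.2 - m).factorial : ℝ))))) / 2) k * t ^ (Sum.elim (fun k : Fin (m + 1) × Fin (N + m + 1) ↦ ((k.2 : ℕ) : ℝ) - ((k.1 : ℕ) : ℝ) - 1 / 2) (fun n : Fin (m + N + 1) ↦ ((n : ℕ) : ℝ) - m) k) : ℝ) : ℂ) - ({i : (Σ l : ℕ, Fin ((l + 2 * m).choose (2 * m))) | ((i.1 : ℝ) * (i.1 + 2 * m)) = 0}.ncard : ℂ)) t) s)) (𝓝[≠] 0) (𝓝 ((((1 * (∑ x ∈ Finset.HasAntidiagonal.antidiagonal m, ((m : ℝ) ^ 2) ^ x.1 / (x.1.factorial : ℝ) *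
        (if x.2 < m then (C (1 / ((2 * m - 1).factorial : ℝ)) * ∏ i ∈ Finset.range (m - 1), (X - C (((i : ℝ) + 1) ^ 2))).coeff (m - 1 - x.2) * ((((m - 1 - x.2).factorial : ℕ) : ℝ) / 2)
        else ∑ k ∈ Finset.range m, (C (1 / ((2 * m - 1).factorial : ℝ)) * ∏ i ∈ Finset.range (m - 1), (X - C (((i : ℝ) + 1) ^ 2))).coeff k * ((-1 : ℝ) ^ (x.2 - m + 1) * (bernoulli (2 * (k + (x.2 - m) + 1)) : ℝ) /
            (2 * ((k + (x.2 - m) + 1 : ℕ) : ℝ) * ((x.2 - m).factorial : ℝ))))) / 2 : ℝ)) : ℂ) - 1)) := by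
  have hβ : (0 : ℝ) < (N : ℝ) + 1 / 2 := by positivity
  have h := tendsto_continuation_nhdsNE_zero (μ := fun i : (Σ l : ℕ, Fin ((l + 2 * m).choose (2 * m))) ↦ ((i.1 : ℝ) * (i.1 + 2 * m)))
    (fun i ↦ by positivity) (tendsto_neumannOddHemisphere_cofinite_atTop m) (fun t ht ↦ summable_neumannOddHemisphere m hm ht)
    (isBigO_neumannOddHemisphere_heatTrace_expansion m hm N) hβ
  have e : ((∑ k : (Fin (m + 1) × Fin (N + m + 1)) ⊕ Fin (m + N + 1), if Sum.elim (fun k : Fin (m + 1) × Fin (N + m + 1) ↦ ((k.2 : ℕ) : ℝ) - ((k.1 : ℕ) : ℝ) - 1 / 2) (fun n : Fin (m + N + 1) ↦ ((n : ℕ) : ℝ) - m) k = 0 then (((Sum.elim (fun k : Fin (m + 1) × Fin (N + m + 1) ↦ 1 / 2 * ((fun k : Fin (m + 1) × Fin (N + m + 1) ↦ 1 / 2 * (C (2 / (Nat.factorial (2 * m) : ℝ)) * X * ∏ i ∈ Finset.range (m - 1), (X - C (((i : ℝ) + 1) ^ 2))).coeff (k.1 : ℕ) * Real.Gamma (((k.1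 : ℕ) : ℝ) + 1 / 2) * ((m : ℝ) ^ 2) ^ (k.2 : ℕ) / ((k.2 : ℕ).factorial : ℝ)) k))
          (fun n : Fin (m + N + 1) ↦ 1 * (∑ x ∈ Finset.HasAntidiagonal.antidiagonal (n : ℕ), ((m : ℝ) ^ 2) ^ x.1 / (x.1.factorial : ℝ) *
        (if x.2 < m then (C (1 / ((2 * m - 1).factorial : ℝ)) * ∏ i ∈ Finset.range (m - 1), (X - C (((i : ℝ) + 1) ^ 2))).coeff (m - 1 - x.2) * ((((m - 1 - x.2).factorial : ℕ) : ℝ) / 2)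
        else ∑ k ∈ Finset.range m, (C (1 / ((2 * m - 1).factorial : ℝ)) * ∏ i ∈ Finset.range (m - 1), (X - C (((i : ℝ) + 1) ^ 2))).coeff k * ((-1 : ℝ) ^ (x.2 - m + 1) * (bernoulli (2 * (k + (x.2 - m) + 1)) : ℝ) /
            (2 * ((k + (x.2 - m) + 1 : ℕ) : ℝ) * ((x.2 - m).factorial : ℝ))))) / 2) k : ℝ)) : ℂ) else 0) -
      ({i : (Σ l : ℕ, Fin ((l + 2 * m).choose (2 * m))) | ((i.1 : ℝ) * (i.1 + 2 * m)) = 0}.ncard : ℂ)) = ((((1 * (∑ x ∈ Finset.HasAntidiagonal.antidiagonal m, ((m : ℝ) ^ 2) ^ x.1 / (x.1.factorial : ℝ) *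
        (if x.2 < m then (C (1 / ((2 * m - 1).factorial : ℝ)) * ∏ i ∈ Finset.range (m - 1), (X - C (((i : ℝ) + 1) ^ 2))).coeff (m - 1 - x.2) * ((((m - 1 - x.2).factorial : ℕ) : ℝ) / 2)
        else ∑ k ∈ Finset.range m, (C (1 / ((2 * m - 1).factorial : ℝ)) * ∏ i ∈ Finset.range (m - 1), (X - C (((i : ℝ) + 1) ^ 2))).coeff k * ((-1 : ℝ) ^ (x.2 - m + 1) * (bernoulli (2 * (k + (x.2 - m) + 1)) : ℝ) /
            (2 * ((k + (x.2 - m) + 1 : ℕ) : ℝ) * ((x.2 - m).factorial : ℝ))))) / 2 : ℝ)) : ℂ) - 1) := by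
    rw [Fintype.sum_sum_type]
    simp only [Sum.elim_inl, Sum.elim_inr, oddHemisphereSphereExponent_ne_zero, if_false, Finset.sum_const_zero, zero_add,
      oddHemisphereExponent_eq_iff m (m + N + 1) (show m < m + N + 1 by omega) 0 (by ring), Finset.sum_ite_eq', Finset.mem_univ,
      if_true, ncard_setOf_neumannOddHemisphere_eq_zero m hm, Nat.cast_one]
  rw [e] at h
  exact h

/-- **THE INTEGER BOUNDARY POLE OF THE DIRICHLET HEMISPHERE: `Res_{s = m} ζ_D = Γ(m)^{−1}·(−½E_{m,0}) = −1/(4(2m−1)!)`** — the pole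
(at an INTEGER, where `ζ_{S^{2m+1}}` is regular) produced by McKean–Singer's `−¼√(4πt)·area(∂)/(4πt)^{m+½}`; `m = 1`: `−¼` (row
g40-#4), `m = 2`: `−1/24`. [cite: Gilkey1995, §1.10 Lemma 1.10.1 ("isolated simple poles at `s = (m−n)/d` … residue
`aₙ(P)Γ((m−n)/d)^{−1}`"); McKeanSinger1967, eq. (6) p. 45] -/
theorem tendsto_sub_mul_dirichletOddHemisphereZeta_continuation_top (m : ℕ) (hm : 1 ≤ m) (N : ℕ) :
    Tendsto (fun s : ℂ ↦ (s - ((m : ℝ) : ℂ)) * ((Complex.Gamma s)⁻¹ *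
        (∑ k : (Fin (m + 1) × Fin (N + m + 1)) ⊕ Fin (m + N + 1), (((Sum.elim (fun k : Fin (m + 1) × Fin (N + m + 1) ↦ 1 / 2 * ((fun k : Fin (m + 1) × Fin (N + m + 1) ↦ 1 / 2 * (C (2 / (Nat.factorial (2 * m) : ℝ)) * X * ∏ i ∈ Finset.range (m - 1), (X - C (((i : ℝ) + 1) ^ 2))).coeff (k.1 : ℕ) * Real.Gamma (((k.1 : ℕ) : ℝ) + 1 / 2) * ((m : ℝ) ^ 2) ^ (k.2 : ℕ) / ((k.2 : ℕ).factorial : ℝ)) k))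
          (fun n : Fin (m + N + 1) ↦ (-1) * (∑ x ∈ Finset.HasAntidiagonal.antidiagonal (n : ℕ), ((m : ℝ) ^ 2) ^ x.1 / (x.1.factorial : ℝ) *
        (if x.2 < m then (C (1 / ((2 * m - 1).factorial : ℝ)) * ∏ i ∈ Finset.range (m - 1), (X - C (((i : ℝ) + 1) ^ 2))).coeff (m - 1 - x.2) * ((((m - 1 - x.2).factorial : ℕ) : ℝ) / 2)
        else ∑ k ∈ Finset.range m, (C (1 / ((2 * m - 1).factorial : ℝ)) * ∏ i ∈ Finset.range (m - 1), (X - C (((i : ℝ) + 1) ^ 2))).coeff k * ((-1 : ℝ) ^ (x.2 - m + 1) * (bernoulli (2 * (k + (x.2 - m) + 1)) : ℝ) /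
            (2 * ((k + (x.2 - m) + 1 : ℕ) : ℝ) * ((x.2 - m).factorial : ℝ))))) / 2) k : ℝ)) : ℂ) / (s + ((Sum.elim (fun k : Fin (m + 1) × Fin (N + m + 1) ↦ ((k.2 : ℕ) : ℝ) - ((k.1 : ℕ) : ℝ) - 1 / 2) (fun n : Fin (m + N + 1) ↦ ((n : ℕ) : ℝ) - m) k) : ℝ)) -
          ({i : (Σ l : ℕ, Fin ((l + 2 * m - 1).choose (2 * m))) | ((i.1 : ℝ) * (i.1 + 2 * m)) = 0}.ncard : ℂ) / s +
        mellin (fun t : ℝ ↦ ((∑' i : {i : (Σ l : ℕ, Fin ((l + 2 * m - 1).choose (2 * m))) | ((i.1 : ℝ) * (i.1 + 2 * m)) ≠ 0}, rexp (-(t * ((((i : (Σ l : ℕ, Fin ((l + 2 * m - 1).choose (2 * m))))).1 : ℝ) * (((i : (Σ l : ℕ, Fin ((l + 2 * m - 1).choose (2 * m))))).1 + 2 * m)))) : ℝ) : ℂ) -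
          (Ioc 0 1).indicator (fun t : ℝ ↦ ((∑ k : (Fin (m + 1) × Fin (N + m + 1)) ⊕ Fin (m + N + 1), Sum.elim (fun k : Fin (m + 1) × Fin (N + m + 1) ↦ 1 / 2 * ((fun k : Fin (m + 1) × Fin (N + m + 1) ↦ 1 / 2 * (C (2 / (Nat.factorial (2 * m) : ℝ)) * X * ∏ i ∈ Finset.range (m - 1), (X - C (((i : ℝ) + 1) ^ 2))).coeff (k.1 : ℕ) * Real.Gamma (((k.1 : ℕ) : ℝ) + 1 / 2) * ((m : ℝ) ^ 2) ^ (k.2 : ℕ) / ((k.2 : ℕ).factorial : ℝ)) k))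
          (fun n : Fin (m + N + 1) ↦ (-1) * (∑ x ∈ Finset.HasAntidiagonal.antidiagonal (n : ℕ), ((m : ℝ) ^ 2) ^ x.1 / (x.1.factorial : ℝ) *
        (if x.2 < m then (C (1 / ((2 * m - 1).factorial : ℝ)) * ∏ i ∈ Finset.range (m - 1), (X - C (((i : ℝ) + 1) ^ 2))).coeff (m - 1 - x.2) * ((((m - 1 - x.2).factorial : ℕ) : ℝ) / 2)
        else ∑ k ∈ Finset.range m, (C (1 / ((2 * m - 1).factorial : ℝ)) * ∏ i ∈ Finset.range (m - 1), (X - C (((i : ℝ) + 1) ^ 2))).coeff k * ((-1 : ℝ) ^ (x.2 - m + 1) * (bernoulli (2 * (k + (x.2 - m) + 1)) : ℝ) /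
            (2 * ((k + (x.2 - m) + 1 : ℕ) : ℝ) * ((x.2 - m).factorial : ℝ))))) / 2) k * t ^ (Sum.elim (fun k : Fin (m + 1) × Fin (N + m + 1) ↦ ((k.2 : ℕ) : ℝ) - ((k.1 : ℕ) : ℝ) - 1 / 2) (fun n : Fin (m + N + 1) ↦ ((n : ℕ) : ℝ) - m) k) : ℝ) : ℂ) - ({i : (Σ l : ℕ, Fin ((l + 2 * m - 1).choose (2 * m))) | ((i.1 : ℝ) * (i.1 + 2 * m)) = 0}.ncard : ℂ)) t) s))) (𝓝[≠] ((m : ℝ) : ℂ))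
      (𝓝 ((-(1 / (4 * ((2 * m - 1).factorial : ℝ))) : ℝ) : ℂ)) := by
  have hs₀ : -((N : ℝ) + 1 / 2) < (m : ℝ) := by linarith [(N.cast_nonneg : (0 : ℝ) ≤ N), (m.cast_nonneg : (0 : ℝ) ≤ m)]
  have h := tendsto_sub_mul_continuation_nhdsNE (μ := fun i : (Σ l : ℕ, Fin ((l + 2 * m - 1).choose (2 * m))) ↦ ((i.1 : ℝ) * (i.1 + 2 * m)))
    (fun i ↦ by positivity) (tendsto_dirichletOddHemisphere_cofinite_atTop m) (fun t ht ↦ summable_dirichletOddHemisphere m hm ht)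
    (isBigO_dirichletOddHemisphere_heatTrace_expansion m hm N) hs₀
  have hm0 : (m : ℝ) ≠ 0 := by
    have : (1 : ℝ) ≤ m := by exact_mod_cast hm
    linarith
  have e : (Complex.Gamma ((m : ℝ) : ℂ))⁻¹ *
      ((∑ k : (Fin (m + 1) × Fin (N + m + 1)) ⊕ Fin (m + N + 1), if Sum.elim (fun k : Fin (m + 1) × Fin (N + m + 1) ↦ ((k.2 : ℕ) : ℝ) - ((k.1 : ℕ) : ℝ) - 1 / 2) (fun n : Fin (m + N + 1) ↦ ((n : ℕ) : ℝ) - m) k = -(m : ℝ) then (((Sum.elim (fun k : Fin (m + 1) × Fin (N + m + 1) ↦ 1 / 2 * ((fun k : Fin (m + 1) × Fin (N + m + 1) ↦ 1 / 2 * (C (2 / (Nat.factorial (2 * m) : ℝ)) * X * ∏ i ∈ Finset.range (m - 1), (X - C (((i : ℝ) + 1) ^ 2))).coeff (k.1 : ℕ) * Real.Gamma (((k.1 : ℕ) : ℝ) + 1 / 2) * ((m : ℝ) ^ 2) ^ (k.2 : ℕ) / ((k.2 : ℕ).factorial : ℝ)) k))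
          (fun n : Fin (m + N + 1) ↦ (-1) * (∑ x ∈ Finset.HasAntidiagonal.antidiagonal (n : ℕ), ((m : ℝ) ^ 2) ^ x.1 / (x.1.factorial : ℝ) *
        (if x.2 < m then (C (1 / ((2 * m - 1).factorial : ℝ)) * ∏ i ∈ Finset.range (m - 1), (X - C (((i : ℝ) + 1) ^ 2))).coeff (m - 1 - x.2) * ((((m - 1 - x.2).factorial : ℕ) : ℝ) / 2)
        else ∑ k ∈ Finset.range m, (C (1 / ((2 * m - 1).factorial : ℝ)) * ∏ i ∈ Finset.range (m - 1), (X - C (((i : ℝ) + 1) ^ 2))).coeff k * ((-1 : ℝ) ^ (x.2 - m + 1) * (bernoulli (2 * (k + (x.2 - m) + 1)) : ℝ) /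
            (2 * ((k + (x.2 - m) + 1 : ℕ) : ℝ) * ((x.2 - m).factorial : ℝ))))) / 2) k : ℝ)) : ℂ) else 0) -
        if (m : ℝ) = 0 then ({i : (Σ l : ℕ, Fin ((l + 2 * m - 1).choose (2 * m))) | ((i.1 : ℝ) * (i.1 + 2 * m)) = 0}.ncard : ℂ) else 0) =
      ((-(1 / (4 * ((2 * m - 1).factorial : ℝ))) : ℝ) : ℂ) := by
    rw [Fintype.sum_sum_type]
    simp only [Sum.elim_inl, Sum.elim_inr, oddHemisphereSphereExponent_ne_neg, if_false, Finset.sum_const_zero, zero_add,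
      oddHemisphereExponent_eq_iff m (m + N + 1) (show 0 < m + N + 1 by omega) (-(m : ℝ)) (by push_cast; ring),
      Finset.sum_ite_eq', Finset.mem_univ, if_true, hm0, sub_zero, Complex.Gamma_ofReal]
    rw [oddHemisphere_boundaryCoeff_zero m hm, ← Complex.ofReal_inv, ← Complex.ofReal_mul]
    congr 1
    obtain ⟨M, rfl⟩ : ∃ M, m = M + 1 := ⟨m - 1, by omega⟩
    rw [show (((M + 1 : ℕ)) : ℝ) = (M : ℝ) + 1 by push_cast; ring, Real.Gamma_nat_eq_factorial, show M + 1 - 1 = M by omega]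
    have hM : (M.factorial : ℝ) ≠ 0 := by positivity
    have hF : (((2 * (M + 1) - 1).factorial : ℕ) : ℝ) ≠ 0 := by positivity
    field_simp
    norm_num
  rw [e] at h
  exact h

/-- **THE INTEGER BOUNDARY POLE OF THE NEUMANN HEMISPHERE: `Res_{s = m} ζ_N = +1/(4(2m−1)!)`** (McKean–Singer's
`+¼√(4πt)·area(∂)`). [cite: Gilkey1995, §1.10 Lemma 1.10.1; McKeanSinger1967, eq. (6) p. 45] -/
theorem tendsto_sub_mul_neumannOddHemisphereZeta_continuation_top (m : ℕ) (hm : 1 ≤ m) (N : ℕ) :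
    Tendsto (fun s : ℂ ↦ (s - ((m : ℝ) : ℂ)) * ((Complex.Gamma s)⁻¹ *
        (∑ k : (Fin (m + 1) × Fin (N + m + 1)) ⊕ Fin (m + N + 1), (((Sum.elim (fun k : Fin (m + 1) × Fin (N + m + 1) ↦ 1 / 2 * ((fun k : Fin (m + 1) × Fin (N + m + 1) ↦ 1 / 2 * (C (2 / (Nat.factorial (2 * m) : ℝ)) * X * ∏ i ∈ Finset.range (m - 1), (X - C (((i : ℝ) + 1) ^ 2))).coeff (k.1 : ℕ) * Real.Gamma (((k.1 : ℕ) : ℝ) + 1 / 2) * ((m : ℝ) ^ 2) ^ (k.2 : ℕ) / ((k.2 : ℕ).factorial : ℝ)) k))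
          (fun n : Fin (m + N + 1) ↦ 1 * (∑ x ∈ Finset.HasAntidiagonal.antidiagonal (n : ℕ), ((m : ℝ) ^ 2) ^ x.1 / (x.1.factorial : ℝ) *
        (if x.2 < m then (C (1 / ((2 * m - 1).factorial : ℝ)) * ∏ i ∈ Finset.range (m - 1), (X - C (((i : ℝ) + 1) ^ 2))).coeff (m - 1 - x.2) * ((((m - 1 - x.2).factorial : ℕ) : ℝ) / 2)
        else ∑ k ∈ Finset.range m, (C (1 / ((2 * m - 1).factorial : ℝ)) * ∏ i ∈ Finset.range (m - 1), (X - C (((i : ℝ) + 1) ^ 2))).coeff k * ((-1 : ℝ) ^ (x.2 - m + 1) * (bernoulli (2 * (k + (x.2 - m) + 1)) : ℝ) /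
            (2 * ((k + (x.2 - m) + 1 : ℕ) : ℝ) * ((x.2 - m).factorial : ℝ))))) / 2) k : ℝ)) : ℂ) / (s + ((Sum.elim (fun k : Fin (m + 1) × Fin (N + m + 1) ↦ ((k.2 : ℕ) : ℝ) - ((k.1 : ℕ) : ℝ) - 1 / 2) (fun n : Fin (m + N + 1) ↦ ((n : ℕ) : ℝ) - m) k) : ℝ)) -
          ({i : (Σ l : ℕ, Fin ((l + 2 * m).choose (2 * m))) | ((i.1 : ℝ) * (i.1 + 2 * m)) = 0}.ncard : ℂ) / s +
        mellin (fun t : ℝ ↦ ((∑' i : {i : (Σ l : ℕ, Fin ((l + 2 * m).choose (2 * m))) | ((i.1 : ℝ) * (i.1 + 2 * m)) ≠ 0}, rexp (-(t * ((((i : (Σ l : ℕ, Fin ((l + 2 * m).choose (2 * m))))).1 : ℝ) * (((i : (Σ l : ℕ, Fin ((l + 2 * m).choose (2 * m))))).1 + 2 * m)))) : ℝ) : ℂ) -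
          (Ioc 0 1).indicator (fun t : ℝ ↦ ((∑ k : (Fin (m + 1) × Fin (N + m + 1)) ⊕ Fin (m + N + 1), Sum.elim (fun k : Fin (m + 1) × Fin (N + m + 1) ↦ 1 / 2 * ((fun k : Fin (m + 1) × Fin (N + m + 1) ↦ 1 / 2 * (C (2 / (Nat.factorial (2 * m) : ℝ)) * X * ∏ i ∈ Finset.range (m - 1), (X - C (((i : ℝ) + 1) ^ 2))).coeff (k.1 : ℕ) * Real.Gamma (((k.1 : ℕ) : ℝ) + 1 / 2) * ((m : ℝ) ^ 2) ^ (k.2 : ℕ) / ((k.2 : ℕ).factorial : ℝ)) k))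
          (fun n : Fin (m + N + 1) ↦ 1 * (∑ x ∈ Finset.HasAntidiagonal.antidiagonal (n : ℕ), ((m : ℝ) ^ 2) ^ x.1 / (x.1.factorial : ℝ) *
        (if x.2 < m then (C (1 / ((2 * m - 1).factorial : ℝ)) * ∏ i ∈ Finset.range (m - 1), (X - C (((i : ℝ) + 1) ^ 2))).coeff (m - 1 - x.2) * ((((m - 1 - x.2).factorial : ℕ) : ℝ) / 2)
        else ∑ k ∈ Finset.range m, (C (1 / ((2 * m - 1).factorial : ℝ)) * ∏ i ∈ Finset.range (m - 1), (X - C (((i : ℝ) + 1) ^ 2))).coeff k * ((-1 : ℝ) ^ (x.2 - m + 1) * (bernoulli (2 * (k + (x.2 - m) + 1)) : ℝ) /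
            (2 * ((k + (x.2 - m) + 1 : ℕ) : ℝ) * ((x.2 - m).factorial : ℝ))))) / 2) k * t ^ (Sum.elim (fun k : Fin (m + 1) × Fin (N + m + 1) ↦ ((k.2 : ℕ) : ℝ) - ((k.1 : ℕ) : ℝ) - 1 / 2) (fun n : Fin (m + N + 1) ↦ ((n : ℕ) : ℝ) - m) k) : ℝ) : ℂ) - ({i : (Σ l : ℕ, Fin ((l + 2 * m).choose (2 * m))) | ((i.1 : ℝ) * (i.1 + 2 * m)) = 0}.ncard : ℂ)) t) s))) (𝓝[≠] ((m : ℝ) : ℂ))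
      (𝓝 ((1 / (4 * ((2 * m - 1).factorial : ℝ)) : ℝ) : ℂ)) := by
  have hs₀ : -((N : ℝ) + 1 / 2) < (m : ℝ) := by linarith [(N.cast_nonneg : (0 : ℝ) ≤ N), (m.cast_nonneg : (0 : ℝ) ≤ m)]
  have h := tendsto_sub_mul_continuation_nhdsNE (μ := fun i : (Σ l : ℕ, Fin ((l + 2 * m).choose (2 * m))) ↦ ((i.1 : ℝ) * (i.1 + 2 * m)))
    (fun i ↦ by positivity) (tendsto_neumannOddHemisphere_cofinite_atTop m) (fun t ht ↦ summable_neumannOddHemisphere m hm ht)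
    (isBigO_neumannOddHemisphere_heatTrace_expansion m hm N) hs₀
  have hm0 : (m : ℝ) ≠ 0 := by
    have : (1 : ℝ) ≤ m := by exact_mod_cast hm
    linarith
  have e : (Complex.Gamma ((m : ℝ) : ℂ))⁻¹ *
      ((∑ k : (Fin (m + 1) × Fin (N + m + 1)) ⊕ Fin (m + N + 1), if Sum.elim (fun k : Fin (m + 1) × Fin (N + m + 1) ↦ ((k.2 : ℕ) : ℝ) - ((k.1 : ℕ) : ℝ) - 1 / 2) (fun n : Fin (m + N + 1) ↦ ((n : ℕ) : ℝ) - m) k = -(m : ℝ) then (((Sum.elim (fun k : Fin (m + 1) × Fin (N + m + 1) ↦ 1 / 2 * ((fun k : Fin (m + 1) × Fin (N + m + 1) ↦ 1 / 2 * (C (2 / (Nat.factorial (2 * m) : ℝ)) * X * ∏ i ∈ Finset.range (m - 1), (X - C (((i : ℝ) + 1) ^ 2))).coeff (k.1 : ℕ) * Real.Gamma (((k.1 : ℕ) : ℝ) + 1 / 2) * ((m : ℝ) ^ 2) ^ (k.2 : ℕ) / ((k.2 : ℕ).factorial : ℝ)) k))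
          (fun n : Fin (m + N + 1) ↦ 1 * (∑ x ∈ Finset.HasAntidiagonal.antidiagonal (n : ℕ), ((m : ℝ) ^ 2) ^ x.1 / (x.1.factorial : ℝ) *
        (if x.2 < m then (C (1 / ((2 * m - 1).factorial : ℝ)) * ∏ i ∈ Finset.range (m - 1), (X - C (((i : ℝ) + 1) ^ 2))).coeff (m - 1 - x.2) * ((((m - 1 - x.2).factorial : ℕ) : ℝ) / 2)
        else ∑ k ∈ Finset.range m, (C (1 / ((2 * m - 1).factorial : ℝ)) * ∏ i ∈ Finset.range (m - 1), (X - C (((i : ℝ) + 1) ^ 2))).coeff k * ((-1 : ℝ) ^ (x.2 - m + 1) * (bernoulli (2 * (k + (x.2 - m) + 1)) : ℝ) /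
            (2 * ((k + (x.2 - m) + 1 : ℕ) : ℝ) * ((x.2 - m).factorial : ℝ))))) / 2) k : ℝ)) : ℂ) else 0) -
        if (m : ℝ) = 0 then ({i : (Σ l : ℕ, Fin ((l + 2 * m).choose (2 * m))) | ((i.1 : ℝ) * (i.1 + 2 * m)) = 0}.ncard : ℂ) else 0) =
      (((1 / (4 * ((2 * m - 1).factorial : ℝ))) : ℝ) : ℂ) := by
    rw [Fintype.sum_sum_type]
    simp only [Sum.elim_inl, Sum.elim_inr, oddHemisphereSphereExponent_ne_neg, if_false, Finset.sum_const_zero, zero_add,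
      oddHemisphereExponent_eq_iff m (m + N + 1) (show 0 < m + N + 1 by omega) (-(m : ℝ)) (by push_cast; ring),
      Finset.sum_ite_eq', Finset.mem_univ, if_true, hm0, sub_zero, Complex.Gamma_ofReal]
    rw [oddHemisphere_boundaryCoeff_zero m hm, ← Complex.ofReal_inv, ← Complex.ofReal_mul]
    congr 1
    obtain ⟨M, rfl⟩ : ∃ M, m = M + 1 := ⟨m - 1, by omega⟩
    rw [show (((M + 1 : ℕ)) : ℝ) = (M : ℝ) + 1 by push_cast; ring, Real.Gamma_nat_eq_factorial, show M + 1 - 1 = M by omega]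
    have hM : (M.factorial : ℝ) ≠ 0 := by positivity
    have hF : (((2 * (M + 1) - 1).factorial : ℕ) : ℝ) ≠ 0 := by positivity
    field_simp
    norm_num
  rw [e] at h
  exact h

end Literature.Analysis.InnerProduct
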